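import Literature.Analysis.FluidPDE.ForwardDSSExistenceLocal
import Literature.Analysis.FluidPDE.SuitableWeakPressure
import Literature.Analysis.FluidPDE.DistributionalPressurePoisson
import Literature.Analysis.FluidPDE.SpaceTimeMollifier
import Literature.Analysis.FluidPDE.MollifiedField
import Literature.Analysis.FunctionSpaces.Mollification
import HarnessLib

/-!
# Forward DSS solutions: Prop. 3.1 of Bradshaw–Tsai 2019 with a DSS pressure, proved from Prop. 3.1

Analysis/FluidPDE proofs file (no new definitions) for the named fact
`Literature.Analysis.FluidPDE.bradshawTsai2019_prop_3_1_dss` of `ForwardDSSExistenceLocal.lean`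
(Bradshaw–Tsai, *Discretely self-similar solutions to the Navier–Stokes equations with data in
`L²_loc` satisfying the local energy inequality*, Analysis & PDE 12 (2019) = arXiv:1801.08060,
**Proposition 3.1** with the clause "the associated pressure is `λ`-DSS"). That fact is
`bradshawTsai2019_prop_3_1` (accepted, not proved: it contains the existence theorem of [BT1] for
`λ`-DSS local Leray solutions with `L³_w` data together with the new a priori bound (3.1)–(3.2),
a theory neither Mathlib nor the tree has) **plus** the DSS invariance of the pressure, which the
printed proof obtains from the explicit pressure formula (3.3)/(3.11) after the normalisation
"we can re-define `π_ε` to equal `π_ε − π_*(t)`" (arXiv p. 9).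

**Main result** (`bradshawTsai2019_prop_3_1_dss_of_prop_3_1`): the clause costs nothing —
`bradshawTsai2019_prop_3_1 → bradshawTsai2019_prop_3_1_dss`. Indeed (`IsLocalLeraySolution.exists_dss_pressure`)
*every* local Leray solution `(v, π)` with `λ`-DSS velocity admits a `λ`-DSS pressure `π'` with
`(v, π')` again a local Leray solution (same datum, same velocity) and
`‖π'‖_{L^{3/2}((0,T)×B₁)}^{3/2} ≤ K(λ) ‖π‖_{L^{3/2}((0,T)×B₁)}^{3/2}` for all `T > 0`. Consequently the
trust base of Theorem 1.2 (`bradshawTsai2019_dss_existence`, hence `chae_wolf_dss_existence`,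
`chaeWolf2018_dss_existence`) becomes `{bradshawTsai2019_lemma_4_1, bradshawTsai2019_prop_3_1,
bradshawTsai2019_limit_4_3_local}` (`bradshawTsai2019_dss_existence_of_prop_3_1_local`), in which
the re-scaling argument of §4.3 is proved (`ForwardDSSExtension`) and the limit fact is only
asked for on the unit cylinder.

## The argument

Let `(v, π)` be a local Leray solution on `(0, ∞) × ℝ³` with `v` `λ`-DSS, `λ > 1`, `q = λ⁻²`.

1. *Two pressures.* The Navier–Stokes rescaling of `(v, π)` by `λ` is again a suitable weak
   solution (CKN 1982, §2; tree `IsSuitableWeakSolutionOn.stRescale`) and its velocity is `v`;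
   so `π^λ = λ² π(λ²·, λ·)` is a second pressure for `v`
   (`IsSuitableWeakSolutionOn.nsRescalePressure_of_isDiscretelySelfSimilar`).
2. *`∇(π^λ − π) = 0`.* Testing both momentum equations with `θ w` (`θ ∈ C_c^∞`, `w ∈ ℝ³`; the
   velocity terms are integrable, so the identities may be subtracted) gives
   `∫∫ (π^λ − π) ∂_w θ = 0` (`IsDistributionalNSSolutionOn.integral_sub_mul_fderiv_eq_zero`).
3. *Functions with vanishing weak `x`-gradient are functions of time*
   (`exists_ae_eq_comp_fst_of_forall_integral_mul_fderiv_eq_zero`): `π^λ − π = η(t)` a.e., with `η`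
   measurable. Proof: by the fundamental lemma of the calculus of variations in `t`, a.e. slice
   annihilates the `x`-derivatives of countably many reflected translates `φₙ(q_k − ·)` of a
   mollifier sequence (cut off in time by countably many bumps covering the time axis, Lindelöf);
   the mollified slices then have derivatives vanishing on a dense set, hence everywhere, hence
   are constant; and mollifications converge a.e. (Lebesgue differentiation).
4. *The time correction* (`exists_time_correction`): `g(t) = Σ_{n≥1} qⁿ η(qⁿ t)` converges in
   `L^{3/2}(0, τ)` for every `τ` (Minkowski termwise; the `n`-th term has norm
   `≤ q^{n/3} ‖η‖_{L^{3/2}(0,qτ)}`), solves `g(t) = q η(qt) + q g(qt)` a.e., i.e.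
   `λ² g(λ² t) − g(t) = η(t)`, and `‖g‖_{L^{3/2}(0,τ)} ≤ K_q ‖η‖_{L^{3/2}(0,qτ)}`. (It is the unique
   solution integrable up to `t = 0`; the homogeneous solutions behave like `1/t`.)
5. `π₀ = π − g(t)` is again a pressure for `v`, `(v, π₀)` a local Leray solution (tree
   `IsSuitableWeakSolutionOn.sub_pressure`; `g ∈ L^{3/2}_loc([0, ∞))`), and `π₀^λ = π₀` a.e.;
   an everywhere-DSS representative exists (`exists_nsRescalePressure_eq_of_ae`) and may replace
   `π₀` (`IsSuitableWeakSolutionOn.congr_pressure_ae`).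
6. *Constants.* `η` on `(0, qT)` is controlled by `π^λ − π` on `(0, qT) × B_{1/λ}`, i.e. by `π` on
   `(0, T) × B₁` (change of variables), whence `∫₀ᵀ∫_{B₁}|π'|^{3/2} ≤ K(λ) ∫₀ᵀ∫_{B₁}|π|^{3/2}` with
   `K(λ)` depending only on `λ` (volumes of `B₁`, `B_{1/λ}`, and `Σ q^{n/3}`).

## References

* Z. Bradshaw, T.-P. Tsai, Analysis & PDE 12 (2019) 1943–1962 = arXiv:1801.08060: Prop. 3.1
  (p. 8) and its proof, in particular the normalisation of the pressure and the formula (3.11)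
  (p. 9) [BradshawTsai2019].
* L. Caffarelli, R. Kohn, L. Nirenberg, Comm. Pure Appl. Math. 35 (1982), §2 (suitable weak
  solutions, scaling, the pressure enters through `∇p`) [CaffarelliKohnNirenberg1982].
* F. Lin, Comm. Pure Appl. Math. 51 (1998), §3 (normalised pressures) [Lin1998].
* L. C. Evans, *Partial Differential Equations*, 2nd ed., App. C.4 Thm. 7 (mollifiers) [Evans2010].
-/

noncomputable section

open MeasureTheory TopologicalSpace Set Function Filter Topology Metric ContinuousLinearMap
open scoped InnerProductSpace RealInnerProductSpace ENNReal NNReal Convolution ContDiff Laplacian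

namespace Literature.Analysis.FluidPDE

section PartOne

variable {E : Type*} [NormedAddCommGroup E] [InnerProductSpace ℝ E] [FiniteDimensional ℝ E]
  [MeasurableSpace E] [BorelSpace E]

/-! ### Weakly gradient-free functions are constant (countable criterion) -/

section SpaceConst

/-- **Countable criterion for a.e. constancy.** Let `f : E → ℝ` be locally integrable and let
`φₙ` be a mollifier sequence (`FunctionSpaces.exists_contDiffBump_seq`). If the pairings
`∫ f ∂_{bᵢ}[φₙ.normed (q - ·)]` vanish for all `n`, all points `q` of a dense set `D` and all
vectors `bᵢ` of the standard orthonormal frame, then `f` is a.e. equal to a constant: the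
mollifications `φₙ.normed ⋆ f` are `C¹` with `∂_{bᵢ}(φₙ.normed ⋆ f)(x) = -∫ f ∂_{bᵢ}[φₙ.normed (x - ·)]`,
a continuous function of `x` vanishing on `D`, hence everywhere; so each mollification is
constant, and `φₙ.normed ⋆ f → f` a.e. (Lebesgue differentiation; Evans, *PDE*, App. C.4,
Thm. 7). [folklore] -/
theorem exists_ae_eq_const_of_forall_integral_mul_fderiv_normed_eq_zero
    {φ : ℕ → ContDiffBump (0 : E)} (hφ0 : Tendsto (fun n => (φ n).rOut) atTop (𝓝 0))
    (hφ2 : ∀ n, (φ n).rOut ≤ 2 * (φ n).rIn) {D : Set E} (hD : Dense D)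
    {f : E → ℝ} (hf : LocallyIntegrable f volume)
    (h0 : ∀ n, ∀ q ∈ D, ∀ i,
      ∫ y, f y * fderiv ℝ (fun z => (φ n).normed volume (q - z)) y
        (stdOrthonormalBasis ℝ E i) = 0) :
    ∃ c : ℝ, f =ᵐ[volume] fun _ => c := by
  set b := stdOrthonormalBasis ℝ E with hb
  set ψ : ℕ → E → ℝ := fun n => (φ n).normed volume with hψ
  set m : ℕ → E → ℝ := fun n => ψ n ⋆[lsmul ℝ ℝ, volume] f with hm
  have hψt : ∀ n, FunctionSpaces.IsTestFunctionOn (⊤ : Opens E) (ψ n) := fun n =>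
    FunctionSpaces.isTestFunctionOn_normed (φ n)
  have hψ1 : ∀ n, ContDiff ℝ 1 (ψ n) := fun n =>
    (hψt n).contDiff.of_le (by
      change ((1 : ℕ∞) : WithTop ℕ∞) ≤ ((⊤ : ℕ∞) : WithTop ℕ∞)
      exact_mod_cast le_top)
  have hm1 : ∀ n, ContDiff ℝ 1 (m n) := fun n =>
    (hψt n).hasCompactSupport.contDiff_convolution_left _ (hψ1 n) hf
  -- the derivative of the mollification is (minus) the pairing of the hypothesis
  have hder : ∀ n x v, fderiv ℝ (m n) x v =
      -∫ y, f y * fderiv ℝ (fun z => ψ n (x - z)) y v := by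
    intro n x v
    have e1 : fderiv ℝ (m n) x v = ∫ y, (fderiv ℝ (ψ n) (x - y) v) • f y :=
      fderiv_convolution_apply_eq (hψ1 n) (hψt n).hasCompactSupport hf x v
    rw [e1, ← integral_neg]
    refine integral_congr_ae (Eventually.of_forall fun y => ?_)
    simp only [smul_eq_mul]
    rw [fderiv_comp_const_sub_apply' (ψ n) x y v]
    ring
  -- the directional derivatives along the frame vanish identically
  have hzero : ∀ n x i, fderiv ℝ (m n) x (b i) = 0 := by
    intro n x i
    have hcont : Continuous fun y => fderiv ℝ (m n) y (b i) :=
      ((hm1 n).continuous_fderiv one_ne_zero).clm_apply continuous_const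
    have hEq : (fun y => fderiv ℝ (m n) y (b i)) = fun _ => (0 : ℝ) :=
      Continuous.ext_on hD hcont continuous_const fun q hq => by
        show fderiv ℝ (m n) q (b i) = 0
        rw [hder, h0 n q hq i, neg_zero]
    exact congrFun hEq x
  have hfd : ∀ n x, fderiv ℝ (m n) x = 0 := by
    intro n x
    ext w
    rw [← b.sum_repr' w, map_sum, zero_apply]
    exact Finset.sum_eq_zero fun i _ => by rw [map_smul, hzero n x i, smul_zero]
  have hconst : ∀ n x, m n x = m n 0 := fun n x =>
    is_const_of_fderiv_eq_zero ((hm1 n).differentiable one_ne_zero) (hfd n) x 0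
  -- Lebesgue differentiation
  have hlim := FunctionSpaces.ae_tendsto_normed_convolution hφ0 hφ2 hf
  refine ⟨limUnder atTop fun n => m n 0, ?_⟩
  filter_upwards [hlim] with x hx
  have hx' : Tendsto (fun n => m n 0) atTop (𝓝 (f x)) := by
    have e : (fun n => ((φ n).normed volume ⋆[lsmul ℝ ℝ, volume] f) x) = fun n => m n 0 := by
      funext n
      exact hconst n x
    rw [← e]
    exact hx
  exact (hx'.limUnder_eq).symm

end SpaceConst

/-! ### Weakly `x`-gradient-free space–time functions are functions of time -/

section TimeFunction

omit [InnerProductSpace ℝ E] [FiniteDimensional ℝ E] [MeasurableSpace E] [BorelSpace E] in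
/-- A smooth compactly supported cut-off in an open set of times which equals `1` at a given
point (Mathlib `exists_contDiff_tsupport_subset`). [folklore] -/
theorem exists_contDiff_tsupport_subset_eq_one {I : Set ℝ} (hI : IsOpen I) {t₀ : ℝ}
    (ht₀ : t₀ ∈ I) :
    ∃ χ : ℝ → ℝ, ContDiff ℝ (⊤ : ℕ∞) χ ∧ HasCompactSupport χ ∧ tsupport χ ⊆ I ∧ χ t₀ = 1 := by
  obtain ⟨χ, h1, h2, h3, -, h5⟩ := exists_contDiff_tsupport_subset (n := ⊤) (hI.mem_nhds ht₀)
  exact ⟨χ, h3, h2, h1, h5⟩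

omit [InnerProductSpace ℝ E] [FiniteDimensional ℝ E] [MeasurableSpace E] [BorelSpace E] in
/-- **Countably many cut-offs suffice** (Lindelöf): for an open set of times `I` there is a
countable family of smooth compactly supported functions with supports in `I` such that every
point of `I` is a non-zero of one of them. [folklore] -/
theorem exists_countable_cutoffs {I : Set ℝ} (hI : IsOpen I) :
    ∃ S : Set I, S.Countable ∧ ∃ χ : I → ℝ → ℝ, (∀ s, ContDiff ℝ (⊤ : ℕ∞) (χ s)) ∧
      (∀ s, HasCompactSupport (χ s)) ∧ (∀ s, tsupport (χ s) ⊆ I) ∧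
      ∀ t : I, ∃ s ∈ S, χ s t ≠ 0 := by
  have hχ : ∀ s : I, ∃ χ : ℝ → ℝ, ContDiff ℝ (⊤ : ℕ∞) χ ∧ HasCompactSupport χ ∧
      tsupport χ ⊆ I ∧ χ s = 1 := fun s => exists_contDiff_tsupport_subset_eq_one hI s.2
  choose χ hχs hχc hχI hχ1 using hχ
  have hU : ∀ s : I, {t : I | χ s (t : ℝ) ≠ 0} ∈ 𝓝 s := by
    intro s
    have ho : IsOpen {t : I | χ s (t : ℝ) ≠ 0} :=
      isOpen_ne.preimage ((hχs s).continuous.comp continuous_subtype_val)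
    exact ho.mem_nhds (by simp [hχ1 s])
  obtain ⟨S, hSc, hSU⟩ := TopologicalSpace.countable_cover_nhds hU
  refine ⟨S, hSc, χ, hχs, hχc, hχI, fun t => ?_⟩
  have ht : t ∈ ⋃ s ∈ S, {t : I | χ s (t : ℝ) ≠ 0} := by
    rw [hSU]
    exact mem_univ _
  simpa only [mem_iUnion, mem_setOf_eq, exists_prop] using ht

/-- **Weakly `x`-gradient-free space–time functions are functions of time (slice form).** Let
`I` be an open set of times and `F : ℝ → E → ℝ` locally integrable on the slab `I × E` with
`∫∫ F ∂_v θ = 0` for every test function `θ ∈ C_c^∞(I × E)` and every direction `v` (i.e.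
`∇ₓ F = 0` in `𝒟'(I × E)`). Then for a.e. `t ∈ I` the slice `F(t, ·)` is a.e. equal to a
constant. (Test with `χ(t) φₙ(q - x)` for countably many cut-offs `χ`, mollifiers `φₙ` and
points `q` of a dense sequence; the fundamental lemma of the calculus of variations in `t`
(`ae_integral_inner_gradient_eq_zero`) makes the countably many pairings of a.e. slice vanish,
and the countable criterion `exists_ae_eq_const_of_forall_integral_mul_fderiv_normed_eq_zero`
applies to a.e. slice.) This is the distributional statement "`∇p₁ = ∇p₂` implies
`p₁ - p₂ = c(t)`" behind the normalisation of the pressure (Caffarelli–Kohn–Nirenberg 1982,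
§2; Lin 1998, §3). [folklore] -/
theorem ae_restrict_exists_ae_eq_const_of_forall_integral_mul_fderiv_eq_zero
    {I : Set ℝ} (hI : IsOpen I) {F : ℝ → E → ℝ}
    (hF : LocallyIntegrableOn (uncurry F) ((slab E I hI : Opens (ℝ × E)) : Set (ℝ × E)) volume)
    (h0 : ∀ θ : ℝ → E → ℝ, IsSpaceTimeTestOn (slab E I hI) θ → ∀ v : E,
      ∫ z in ((slab E I hI : Opens (ℝ × E)) : Set (ℝ × E)),
        F z.1 z.2 * fderiv ℝ (θ z.1) z.2 v = 0) :
    ∀ᵐ t ∂(volume.restrict I), ∃ c : ℝ, F t =ᵐ[volume] fun _ => c := by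
  set Q : Opens (ℝ × E) := slab E I hI with hQ
  set b := stdOrthonormalBasis ℝ E with hb
  obtain ⟨φ, hφ0, hφ2⟩ := FunctionSpaces.exists_contDiffBump_seq (E := E)
  set ψ : ℕ → E → ℝ := fun n => (φ n).normed volume with hψ
  have hψt : ∀ n, FunctionSpaces.IsTestFunctionOn (⊤ : Opens E) (ψ n) := fun n =>
    FunctionSpaces.isTestFunctionOn_normed (φ n)
  haveI : Nonempty E := ⟨0⟩
  set q : ℕ → E := TopologicalSpace.denseSeq E with hq
  have hqd : DenseRange q := TopologicalSpace.denseRange_denseSeq E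
  obtain ⟨S, hSc, χ, hχs, hχc, hχI, hScov⟩ := exists_countable_cutoffs hI
  -- (A) the pairings of a.e. slice with the countably many reflected translates vanish
  have hA : ∀ (s : I) (n k : ℕ) (i : _), ∀ᵐ t : ℝ,
      χ s t * ∫ x, F t x * fderiv ℝ (fun z => ψ n (q k - z)) x (b i) = 0 := by
    intro s n k i
    have hΘ : IsSpaceTimeTestOn Q (fun t x => χ s t • ψ n (q k - x)) :=
      isSpaceTimeTestOn_slab_smul hI (hχs s) (hχc s) (hχI s) ((hψt n).comp_sub_left (q k))
    set u : ℝ → E → E := fun t x => F t x • b i with hu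
    have huli : LocallyIntegrableOn (uncurry u) (Q : Set (ℝ × E)) volume := by
      intro z hz
      obtain ⟨U, hU, hFU⟩ := hF z hz
      exact ⟨U, hU, hFU.smul_const _⟩
    have hudiv : ∀ θ : ℝ → E → ℝ, IsSpaceTimeTestOn Q θ →
        ∫ z in (Q : Set (ℝ × E)), ⟪u z.1 z.2, gradient (θ z.1) z.2⟫ = 0 := by
      intro θ hθ
      have e : ∀ z : ℝ × E, ⟪u z.1 z.2, gradient (θ z.1) z.2⟫ =
          F z.1 z.2 * fderiv ℝ (θ z.1) z.2 (b i) := by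
        intro z
        show ⟪F z.1 z.2 • b i, gradient (θ z.1) z.2⟫ = _
        rw [real_inner_smul_left, ← fderiv_apply_eq_inner_gradient]
      simp_rw [e]
      exact h0 θ hθ (b i)
    have key := ae_integral_inner_gradient_eq_zero huli hudiv hΘ
    filter_upwards [key] with t ht
    have hd : ∀ x, DifferentiableAt ℝ (fun z => ψ n (q k - z)) x := fun x =>
      (((hψt n).comp_sub_left (q k)).contDiff.differentiable (by simp)).differentiableAt
    have e : ∀ x, ⟪u t x, gradient (fun x => χ s t • ψ n (q k - x)) x⟫ =
        χ s t * (F t x * fderiv ℝ (fun z => ψ n (q k - z)) x (b i)) := by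
      intro x
      show ⟪F t x • b i, gradient (fun x => χ s t • ψ n (q k - x)) x⟫ = _
      rw [real_inner_smul_left, ← fderiv_apply_eq_inner_gradient]
      have e2 : (fun x => χ s t • ψ n (q k - x)) = fun x => χ s t * ψ n (q k - x) := rfl
      rw [e2, fderiv_const_mul (hd x), smul_apply, smul_eq_mul]
      ring
    simp_rw [e, integral_const_mul] at ht
    exact ht
  -- (B) a.e. slice, cut off in time, is integrable on every ball
  have hB : ∀ (s : I) (N : ℕ), ∀ᵐ t : ℝ,
      IntegrableOn (fun x => χ s t * F t x) (closedBall (0 : E) N) volume := by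
    intro s N
    set K : Set (ℝ × E) := tsupport (χ s) ×ˢ closedBall (0 : E) N with hK
    have hKc : IsCompact K := (hχc s).isCompact.prod (isCompact_closedBall _ _)
    have hKQ : K ⊆ (Q : Set (ℝ × E)) := fun z hz => by
      rw [hQ, coe_slab]
      exact ⟨hχI s hz.1, mem_univ _⟩
    have hFK : IntegrableOn (uncurry F) K volume := hF.integrableOn_compact_subset hKQ hKc
    obtain ⟨C, hC⟩ := (hχs s).continuous.bounded_above_of_compact_support (hχc s)
    have h1 : IntegrableOn (fun z : ℝ × E => χ s z.1 * uncurry F z) K volume :=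
      Integrable.bdd_mul hFK
        (((hχs s).continuous.comp continuous_fst).aestronglyMeasurable) (ae_of_all _ fun z => hC z.1)
    have h2 : IntegrableOn (fun z : ℝ × E => χ s z.1 * uncurry F z)
        ((univ : Set ℝ) ×ˢ closedBall (0 : E) N) volume := by
      refine h1.of_forall_sdiff_eq_zero (MeasurableSet.univ.prod measurableSet_closedBall) ?_
      rintro ⟨t, x⟩ ⟨hz1, hz2⟩
      have ht : t ∉ tsupport (χ s) := fun h => hz2 ⟨h, hz1.2⟩
      simp [image_eq_zero_of_notMem_tsupport ht]
    have h3 : Integrable (fun z : ℝ × E => χ s z.1 * uncurry F z)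
        ((volume : Measure ℝ).prod ((volume : Measure E).restrict (closedBall (0 : E) N))) := by
      have e : (volume : Measure (ℝ × E)).restrict ((univ : Set ℝ) ×ˢ closedBall (0 : E) N) =
          (volume : Measure ℝ).prod ((volume : Measure E).restrict (closedBall (0 : E) N)) := by
        rw [Measure.volume_eq_prod, ← Measure.prod_restrict, Measure.restrict_univ]
      rw [IntegrableOn, e] at h2
      exact h2
    exact h3.prod_right_ae
  -- (C) combine along the countable families
  have hall : ∀ᵐ t ∂(volume.restrict I),
      (∀ s ∈ S, ∀ n k : ℕ, ∀ i,
        χ s t * ∫ x, F t x * fderiv ℝ (fun z => ψ n (q k - z)) x (b i) = 0) ∧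
      (∀ s ∈ S, ∀ N : ℕ, IntegrableOn (fun x => χ s t * F t x) (closedBall (0 : E) N) volume) := by
    refine ae_restrict_of_ae (Eventually.and ?_ ?_)
    · exact (ae_ball_iff hSc).2 fun s _ =>
        ae_all_iff.2 fun n => ae_all_iff.2 fun k => ae_all_iff.2 fun i => hA s n k i
    · exact (ae_ball_iff hSc).2 fun s _ => ae_all_iff.2 fun N => hB s N
  filter_upwards [ae_restrict_mem hI.measurableSet, hall] with t htI ht
  obtain ⟨h1, h2⟩ := ht
  obtain ⟨s, hsS, hst⟩ := hScov ⟨t, htI⟩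
  -- the slice is locally integrable
  have hfl : LocallyIntegrable (F t) volume := by
    intro x
    refine ⟨closedBall (0 : E) (⌈‖x‖⌉₊ + 1 : ℕ), ?_, ?_⟩
    · apply closedBall_mem_nhds_of_mem
      rw [mem_ball_zero_iff]
      push_cast
      exact (Nat.le_ceil ‖x‖).trans_lt (lt_add_one _)
    · have h3 := (h2 s hsS (⌈‖x‖⌉₊ + 1)).const_mul (χ s t)⁻¹
      refine IntegrableOn.congr_fun h3 (fun y _ => ?_) measurableSet_closedBall
      show (χ s t)⁻¹ * (χ s t * F t y) = F t y
      rw [← mul_assoc, inv_mul_cancel₀ hst, one_mul]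
  have hvan : ∀ n, ∀ q' ∈ range q, ∀ i,
      ∫ y, F t y * fderiv ℝ (fun z => ψ n (q' - z)) y (b i) = 0 := by
    rintro n _ ⟨k, rfl⟩ i
    exact (mul_eq_zero.1 (h1 s hsS n k i)).resolve_left hst
  exact exists_ae_eq_const_of_forall_integral_mul_fderiv_normed_eq_zero hφ0 hφ2 hqd hfl hvan

/-- **Weakly `x`-gradient-free space–time functions are functions of time (product form).**
Under the hypotheses of
`ae_restrict_exists_ae_eq_const_of_forall_integral_mul_fderiv_eq_zero` there is a function
`η` of time alone, a.e.-strongly measurable on `I`, with `F(t, x) = η(t)` for a.e.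
`(t, x) ∈ I × E`. (Take for `η(t)` the mean of `F(t, ·)` over the unit ball, measurable by
Fubini; a.e. slice being a.e. constant, the mean is that constant; the passage from "a.e. `t`,
a.e. `x`" to the product measure uses measurable representatives.) [folklore] -/
theorem exists_ae_eq_comp_fst_of_forall_integral_mul_fderiv_eq_zero
    {I : Set ℝ} (hI : IsOpen I) {F : ℝ → E → ℝ}
    (hF : LocallyIntegrableOn (uncurry F) ((slab E I hI : Opens (ℝ × E)) : Set (ℝ × E)) volume)
    (h0 : ∀ θ : ℝ → E → ℝ, IsSpaceTimeTestOn (slab E I hI) θ → ∀ v : E,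
      ∫ z in ((slab E I hI : Opens (ℝ × E)) : Set (ℝ × E)),
        F z.1 z.2 * fderiv ℝ (θ z.1) z.2 v = 0) :
    ∃ η : ℝ → ℝ, AEStronglyMeasurable η (volume.restrict I) ∧
      ∀ᵐ z ∂(volume.restrict (I ×ˢ (univ : Set E))), F z.1 z.2 = η z.1 := by
  have hslice := ae_restrict_exists_ae_eq_const_of_forall_integral_mul_fderiv_eq_zero hI hF h0
  set B : Set E := closedBall (0 : E) 1 with hB
  have hB0 : volume B ≠ 0 := (measure_closedBall_pos volume _ zero_lt_one).ne'
  have hBtop : volume B ≠ ⊤ := measure_closedBall_lt_top.ne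
  have hBr : (volume B).toReal ≠ 0 := ENNReal.toReal_ne_zero.2 ⟨hB0, hBtop⟩
  set μI := (volume : Measure ℝ).restrict I with hμI
  have hprod : (volume : Measure (ℝ × E)).restrict (I ×ˢ (univ : Set E)) = μI.prod volume := by
    rw [Measure.volume_eq_prod, Measure.restrict_prod_eq_prod_univ]
  have hFm : AEStronglyMeasurable (uncurry F) (μI.prod volume) := by
    rw [← hprod]
    exact hF.aestronglyMeasurable
  set η : ℝ → ℝ := fun t => (volume B).toReal⁻¹ * ∫ x in B, F t x with hη
  have hηm : AEStronglyMeasurable η μI := by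
    have h1 : AEStronglyMeasurable (uncurry F) (μI.prod (volume.restrict B)) :=
      hFm.mono_measure (Measure.prod_mono le_rfl Measure.restrict_le_self)
    exact aestronglyMeasurable_const.mul h1.integral_prod_right'
  refine ⟨η, hηm, ?_⟩
  -- a.e. slice equals `η t` a.e.
  have hsl : ∀ᵐ t ∂μI, ∀ᵐ x ∂(volume : Measure E), F t x = η t := by
    filter_upwards [hslice] with t ht
    obtain ⟨c, hc⟩ := ht
    have hηt : η t = c := by
      have e1 : ∫ x in B, F t x = ∫ x in B, c := integral_congr_ae (ae_restrict_of_ae hc)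
      rw [hη]
      simp only
      rw [e1, setIntegral_const, smul_eq_mul, measureReal_def, ← mul_assoc,
        inv_mul_cancel₀ hBr, one_mul]
    filter_upwards [hc] with x hx
    rw [hx, hηt]
  -- measurable representatives and the product measure
  rw [hprod]
  set F' : ℝ × E → ℝ := hFm.mk (uncurry F) with hF'
  set η' : ℝ → ℝ := hηm.mk η with hη'
  have hFF' : uncurry F =ᵐ[μI.prod volume] F' := hFm.ae_eq_mk
  have hηη' : η =ᵐ[μI] η' := hηm.ae_eq_mk
  have hS : MeasurableSet {z : ℝ × E | F' z = η' z.1} :=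
    measurableSet_eq_fun hFm.stronglyMeasurable_mk.measurable
      (hηm.stronglyMeasurable_mk.measurable.comp measurable_fst)
  have h1 : ∀ᵐ t ∂μI, ∀ᵐ x ∂(volume : Measure E), F' (t, x) = η' t := by
    filter_upwards [hsl, Measure.ae_ae_of_ae_prod hFF', hηη'] with t ht1 ht2 ht3
    filter_upwards [ht1, ht2] with x hx1 hx2
    rw [← hx2, uncurry_apply_pair, hx1, ht3]
  have h2 : ∀ᵐ z ∂(μI.prod volume), F' z = η' z.1 :=
    (Measure.ae_prod_iff_ae_ae (μ := μI) (ν := (volume : Measure E))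
      (p := fun z : ℝ × E => F' z = η' z.1) hS).2 h1
  have h3 : (fun z : ℝ × E => η z.1) =ᵐ[μI.prod volume] fun z => η' z.1 :=
    (Measure.quasiMeasurePreserving_fst (μ := μI) (ν := (volume : Measure E))).ae_eq hηη'
  filter_upwards [h2, hFF', h3] with z hz1 hz2 hz3
  have e : F z.1 z.2 = uncurry F z := rfl
  rw [e, hz2, hz1]
  exact hz3.symm

end TimeFunction

end PartOne

section PartTwo

/-! ### The time correction `g(t) = Σ_{n ≥ 1} qⁿ η(qⁿ t)` -/

section TimeCorrection

/-- Change of variables `t ↦ a t` (`a > 0`) in a lower Lebesgue integral over `(0, τ)`: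
`∫_{(0,τ)} G(a t) dt = a⁻¹ ∫_{(0, aτ)} G`. [folklore] -/
theorem setLIntegral_Ioo_comp_mul_left {a : ℝ} (ha : 0 < a) (G : ℝ → ℝ≥0∞) (τ : ℝ) :
    ∫⁻ t in Ioo 0 τ, G (a * t) = ENNReal.ofReal a⁻¹ * ∫⁻ t in Ioo 0 (a * τ), G t := by
  have he : MeasurableEmbedding (fun t : ℝ => a * t) :=
    (Homeomorph.mulLeft₀ a ha.ne').measurableEmbedding
  have hpre : (fun t : ℝ => a * t) ⁻¹' Ioo 0 (a * τ) = Ioo 0 τ := by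
    ext t
    simp only [mem_preimage, mem_Ioo]
    constructor
    · rintro ⟨h1, h2⟩
      exact ⟨(mul_pos_iff_of_pos_left ha).1 h1, lt_of_mul_lt_mul_left h2 ha.le⟩
    · rintro ⟨h1, h2⟩
      exact ⟨mul_pos ha h1, mul_lt_mul_of_pos_left h2 ha⟩
  have h1 : ∫⁻ s in Ioo 0 (a * τ), G s ∂(Measure.map (fun t : ℝ => a * t) volume) =
      ∫⁻ t in Ioo 0 τ, G (a * t) := by
    rw [he.restrict_map, he.lintegral_map, hpre]
  rw [← h1, Real.map_volume_mul_left ha.ne', Measure.restrict_smul, lintegral_smul_measure,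
    abs_of_pos (inv_pos.2 ha)]
  rfl

/-- `t ↦ a t` is quasi-measure-preserving for Lebesgue measure (`a ≠ 0`). [folklore] -/
theorem quasiMeasurePreserving_mul_left {a : ℝ} (ha : a ≠ 0) :
    Measure.QuasiMeasurePreserving (fun t : ℝ => a * t) volume volume := by
  refine ⟨measurable_const_mul a, ?_⟩
  rw [Real.map_volume_mul_left ha]
  exact Measure.smul_absolutelyContinuous

/-- Exponent bookkeeping for the `L^{3/2}` scaling: `(qⁿ⁺¹)^{3/2} (qⁿ⁺¹)⁻¹ = ((q^{1/3})ⁿ⁺¹)^{3/2}`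
(`q > 0`). [folklore] -/
theorem rpow_three_halves_mul_inv_pow {q : ℝ} (hq : 0 < q) (n : ℕ) :
    (q ^ (n + 1)) ^ (3 / 2 : ℝ) * (q ^ (n + 1))⁻¹ = ((q ^ (1 / 3 : ℝ)) ^ (n + 1)) ^ (3 / 2 : ℝ) := by
  have h1 : (q ^ (n + 1)) ^ (3 / 2 : ℝ) * (q ^ (n + 1))⁻¹ = q ^ (((n : ℝ) + 1) / 2) := by
    rw [← Real.rpow_natCast q (n + 1), ← Real.rpow_mul hq.le, ← Real.rpow_neg_one,
      ← Real.rpow_mul hq.le, ← Real.rpow_add hq]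
    congr 1
    push_cast
    ring
  have h2 : ((q ^ (1 / 3 : ℝ)) ^ (n + 1)) ^ (3 / 2 : ℝ) = q ^ (((n : ℝ) + 1) / 2) := by
    rw [← Real.rpow_natCast _ (n + 1), ← Real.rpow_mul hq.le,
      ← Real.rpow_mul hq.le]
    congr 1
    push_cast
    ring
  rw [h1, h2]

/-- **The time correction.** Let `0 < q < 1` and let `η : ℝ → ℝ` be a.e.-strongly measurable with
`∫_{(0,τ)} |η|^{3/2} < ∞` for every `τ > 0`. Then `g(t) = Σ_{n ≥ 1} qⁿ η(qⁿ t)` (the sum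
converging absolutely for a.e. `t > 0`) is a.e.-strongly measurable on `(0, ∞)`, solves the
cohomological equation `g(t) = q η(q t) + q g(q t)` for a.e. `t > 0`, and obeys
`∫_{(0,τ)} |g|^{3/2} ≤ K_q^{3/2} ∫_{(0, qτ)} |η|^{3/2}` with `K_q = Σ_{n ≥ 1} q^{n/3} < ∞`
(Minkowski's inequality termwise and the scaling `∫_{(0,τ)} |η(qⁿ t)|^{3/2} dt =
q^{-n} ∫_{(0,qⁿτ)} |η|^{3/2}`). This is the unique solution of the cohomological equation which
is `L^{3/2}` up to `t = 0`. [folklore] -/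
theorem exists_time_correction {q : ℝ} (hq0 : 0 < q) (hq1 : q < 1) {η : ℝ → ℝ}
    (hηm : AEStronglyMeasurable η volume)
    (hfin : ∀ τ : ℝ, 0 < τ → ∫⁻ t in Ioo 0 τ, ‖η t‖ₑ ^ (3 / 2 : ℝ) < ⊤) :
    ∃ g : ℝ → ℝ, AEStronglyMeasurable g (volume.restrict (Ioi 0)) ∧
      (∀ᵐ t ∂(volume.restrict (Ioi 0)), g t = q * η (q * t) + q * g (q * t)) ∧
      (∑' n : ℕ, ENNReal.ofReal (q ^ (1 / 3 : ℝ)) ^ (n + 1)) ≠ ⊤ ∧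
      ∀ τ : ℝ, 0 < τ → ∫⁻ t in Ioo 0 τ, ‖g t‖ₑ ^ (3 / 2 : ℝ) ≤
        (∑' n : ℕ, ENNReal.ofReal (q ^ (1 / 3 : ℝ)) ^ (n + 1)) ^ (3 / 2 : ℝ) *
          ∫⁻ t in Ioo 0 (q * τ), ‖η t‖ₑ ^ (3 / 2 : ℝ) := by
  -- the terms, their enorms, the majorant and the sum
  set u : ℕ → ℝ → ℝ := fun n t => q ^ (n + 1) * η (q ^ (n + 1) * t) with hu
  set a : ℕ → ℝ → ℝ≥0∞ := fun n t => ‖u n t‖ₑ with ha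
  set Φ : ℝ → ℝ≥0∞ := fun t => ∑' n, a n t with hΦ
  set g : ℝ → ℝ := fun t => ∑' n, u n t with hg
  set ρ : ℝ≥0∞ := ENNReal.ofReal (q ^ (1 / 3 : ℝ)) with hρ
  set Kq : ℝ≥0∞ := ∑' n : ℕ, ρ ^ (n + 1) with hKq
  have hr0 : (0 : ℝ) ≤ 3 / 2 := by norm_num
  have hr1 : (1 : ℝ) ≤ 3 / 2 := by norm_num
  -- measurability of the terms
  have hum : ∀ n, AEStronglyMeasurable (u n) volume := by
    intro n
    have hqn : 0 < q ^ (n + 1) := pow_pos hq0 _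
    have h1 : AEStronglyMeasurable (fun t => η (q ^ (n + 1) * t)) volume :=
      hηm.comp_quasiMeasurePreserving (quasiMeasurePreserving_mul_left hqn.ne')
    exact h1.const_mul _
  have ham : ∀ n, AEMeasurable (a n) volume := fun n => (hum n).enorm
  -- `Kq < ∞`
  have hρ1 : ρ < 1 := by
    rw [hρ]
    exact ENNReal.ofReal_lt_one.2 (Real.rpow_lt_one hq0.le hq1 (by norm_num))
  have hKq_top : Kq ≠ ⊤ := by
    have e : Kq = ρ * ∑' n : ℕ, ρ ^ n := by
      rw [hKq, ← ENNReal.tsum_mul_left]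
      exact tsum_congr fun n => by ring
    rw [e, ENNReal.tsum_geometric]
    exact ENNReal.mul_ne_top ENNReal.ofReal_ne_top
      (ENNReal.inv_ne_top.2 (tsub_pos_of_lt hρ1).ne')
  -- termwise `L^{3/2}` bound
  have hterm : ∀ n (τ : ℝ), 0 < τ →
      (∫⁻ t in Ioo 0 τ, a n t ^ (3 / 2 : ℝ)) ^ (1 / (3 / 2 : ℝ)) ≤
        ρ ^ (n + 1) * (∫⁻ t in Ioo 0 (q * τ), ‖η t‖ₑ ^ (3 / 2 : ℝ)) ^ (1 / (3 / 2 : ℝ)) := by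
    intro n τ hτ
    have hqn : 0 < q ^ (n + 1) := pow_pos hq0 _
    have e1 : ∀ t, a n t ^ (3 / 2 : ℝ) = ENNReal.ofReal (q ^ (n + 1)) ^ (3 / 2 : ℝ) *
        (fun s => ‖η s‖ₑ ^ (3 / 2 : ℝ)) (q ^ (n + 1) * t) := by
      intro t
      simp only [ha, hu]
      rw [enorm_mul, Real.enorm_eq_ofReal hqn.le, ENNReal.mul_rpow_of_nonneg _ _ hr0]
    simp_rw [e1]
    rw [lintegral_const_mul' _ _ (ENNReal.rpow_ne_top_of_nonneg hr0 ENNReal.ofReal_ne_top),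
      setLIntegral_Ioo_comp_mul_left hqn (fun s => ‖η s‖ₑ ^ (3 / 2 : ℝ)) τ, ← mul_assoc]
    have hmono : ∫⁻ t in Ioo 0 (q ^ (n + 1) * τ), ‖η t‖ₑ ^ (3 / 2 : ℝ) ≤
        ∫⁻ t in Ioo 0 (q * τ), ‖η t‖ₑ ^ (3 / 2 : ℝ) := by
      apply lintegral_mono_set
      apply Ioo_subset_Ioo_right
      exact mul_le_mul_of_nonneg_right (pow_le_of_le_one hq0.le hq1.le (Nat.succ_ne_zero n))
        hτ.le
    have hcoef : ENNReal.ofReal (q ^ (n + 1)) ^ (3 / 2 : ℝ) * ENNReal.ofReal (q ^ (n + 1))⁻¹ =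
        (ρ ^ (n + 1)) ^ (3 / 2 : ℝ) := by
      rw [ENNReal.ofReal_rpow_of_pos hqn, ← ENNReal.ofReal_mul (by positivity),
        rpow_three_halves_mul_inv_pow hq0 n, ← ENNReal.ofReal_rpow_of_pos (by positivity), hρ,
        ← ENNReal.ofReal_pow (by positivity)]
    rw [hcoef, ENNReal.mul_rpow_of_nonneg _ _ (by norm_num : (0 : ℝ) ≤ 1 / (3 / 2 : ℝ)),
      one_div, ENNReal.rpow_rpow_inv (by norm_num)]
    gcongr
  -- Minkowski over the partial sums
  have hmink : ∀ (τ : ℝ), 0 < τ → ∀ N : ℕ,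
      (∫⁻ t in Ioo 0 τ, (∑ n ∈ Finset.range N, a n t) ^ (3 / 2 : ℝ)) ^ (1 / (3 / 2 : ℝ)) ≤
        ∑ n ∈ Finset.range N,
          ρ ^ (n + 1) * (∫⁻ t in Ioo 0 (q * τ), ‖η t‖ₑ ^ (3 / 2 : ℝ)) ^ (1 / (3 / 2 : ℝ)) := by
    intro τ hτ N
    induction N with
    | zero =>
      simp only [Finset.range_zero, Finset.sum_empty]
      rw [ENNReal.zero_rpow_of_pos (by norm_num), lintegral_zero,
        ENNReal.zero_rpow_of_pos (by norm_num)]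
    | succ N ih =>
      rw [Finset.sum_range_succ]
      have hmN : AEMeasurable (fun t => ∑ n ∈ Finset.range N, a n t)
          (volume.restrict (Ioo 0 τ)) :=
        Finset.aemeasurable_fun_sum _ fun n _ => (ham n).restrict
      have h1 := ENNReal.lintegral_Lp_add_le (μ := volume.restrict (Ioo 0 τ)) hmN
        (ham N).restrict hr1
      calc (∫⁻ t in Ioo 0 τ, (∑ n ∈ Finset.range (N + 1), a n t) ^ (3 / 2 : ℝ)) ^
            (1 / (3 / 2 : ℝ))
          = (∫⁻ t in Ioo 0 τ, ((fun t => ∑ n ∈ Finset.range N, a n t) + a N) t ^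
              (3 / 2 : ℝ)) ^ (1 / (3 / 2 : ℝ)) := by
            congr 1
            refine lintegral_congr fun t => ?_
            rw [Finset.sum_range_succ, Pi.add_apply]
        _ ≤ (∫⁻ t in Ioo 0 τ, (∑ n ∈ Finset.range N, a n t) ^ (3 / 2 : ℝ)) ^
              (1 / (3 / 2 : ℝ)) +
            (∫⁻ t in Ioo 0 τ, a N t ^ (3 / 2 : ℝ)) ^ (1 / (3 / 2 : ℝ)) := h1
        _ ≤ _ := add_le_add ih (hterm N τ hτ)
  -- the bound on the majorant
  have hΦ_bound : ∀ τ : ℝ, 0 < τ → ∫⁻ t in Ioo 0 τ, Φ t ^ (3 / 2 : ℝ) ≤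
      Kq ^ (3 / 2 : ℝ) * ∫⁻ t in Ioo 0 (q * τ), ‖η t‖ₑ ^ (3 / 2 : ℝ) := by
    intro τ hτ
    set X := ∫⁻ t in Ioo 0 (q * τ), ‖η t‖ₑ ^ (3 / 2 : ℝ) with hX
    set P : ℕ → ℝ → ℝ≥0∞ := fun N t => ∑ n ∈ Finset.range N, a n t with hP
    have hPm : ∀ N, AEMeasurable (P N) (volume.restrict (Ioo 0 τ)) := fun N =>
      Finset.aemeasurable_fun_sum _ fun n _ => (ham n).restrict
    have hPmono : ∀ t, Monotone fun N => P N t := fun t N M hNM =>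
      Finset.sum_le_sum_of_subset (Finset.range_mono hNM)
    have hPN : ∀ N, ∫⁻ t in Ioo 0 τ, P N t ^ (3 / 2 : ℝ) ≤ Kq ^ (3 / 2 : ℝ) * X := by
      intro N
      have h2 : ∑ n ∈ Finset.range N, ρ ^ (n + 1) * X ^ (1 / (3 / 2 : ℝ)) ≤
          Kq * X ^ (1 / (3 / 2 : ℝ)) := by
        rw [← Finset.sum_mul]
        gcongr
        exact ENNReal.sum_le_tsum _
      have h3 := (hmink τ hτ N).trans h2
      have h4 := ENNReal.rpow_le_rpow h3 hr0
      rw [one_div, ENNReal.rpow_inv_rpow (by norm_num), ENNReal.mul_rpow_of_nonneg _ _ hr0,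
        ENNReal.rpow_inv_rpow (by norm_num)] at h4
      exact h4
    have hmono_rpow : Monotone fun x : ℝ≥0∞ => x ^ (3 / 2 : ℝ) :=
      ENNReal.monotone_rpow_of_nonneg hr0
    calc ∫⁻ t in Ioo 0 τ, Φ t ^ (3 / 2 : ℝ)
        = ∫⁻ t in Ioo 0 τ, ⨆ N, P N t ^ (3 / 2 : ℝ) := by
          refine lintegral_congr fun t => ?_
          have e : Φ t = ⨆ N, P N t := ENNReal.tsum_eq_iSup_nat
          rw [e]
          exact hmono_rpow.map_iSup_of_continuousAt ENNReal.continuous_rpow_const.continuousAt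
            (by simp [ENNReal.zero_rpow_of_pos])
      _ = ⨆ N, ∫⁻ t in Ioo 0 τ, P N t ^ (3 / 2 : ℝ) := by
          refine lintegral_iSup' (fun N => (hPm N).pow_const _) (ae_of_all _ fun t => ?_)
          exact fun N M hNM => hmono_rpow (hPmono t hNM)
      _ ≤ Kq ^ (3 / 2 : ℝ) * X := iSup_le hPN
  -- the majorant is finite a.e. on `(0, ∞)`
  have hΦm : ∀ s : Set ℝ, AEMeasurable Φ (volume.restrict s) := fun s =>
    AEMeasurable.tsum fun n => (ham n).restrict
  have hΦ_fin : ∀ᵐ t ∂(volume.restrict (Ioi 0)), Φ t < ⊤ := by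
    have hcov : Ioi (0 : ℝ) = ⋃ N : ℕ, Ioo 0 ((N : ℝ) + 1) := by
      ext t
      simp only [mem_Ioi, mem_iUnion, mem_Ioo]
      constructor
      · intro ht
        exact ⟨⌈t⌉₊, ht, (Nat.le_ceil t).trans_lt (lt_add_one _)⟩
      · rintro ⟨N, h1, -⟩
        exact h1
    rw [hcov, ae_restrict_iUnion_iff]
    intro N
    have hτ : (0 : ℝ) < N + 1 := by positivity
    have hlt : ∫⁻ t in Ioo 0 ((N : ℝ) + 1), Φ t ^ (3 / 2 : ℝ) < ⊤ :=
      (hΦ_bound _ hτ).trans_lt (ENNReal.mul_lt_top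
        (ENNReal.rpow_lt_top_of_nonneg hr0 hKq_top) (hfin _ (mul_pos hq0 hτ)))
    filter_upwards [ae_lt_top' ((hΦm _).pow_const _) hlt.ne] with t ht
    by_contra h
    rw [not_lt, top_le_iff] at h
    rw [h, ENNReal.top_rpow_of_pos (by norm_num)] at ht
    exact lt_irrefl _ ht
  -- summability and the cohomological equation where the majorant is finite
  have hsum : ∀ t, Φ t < ⊤ → Summable fun n => u n t := by
    intro t ht
    have h1 : (∑' n, (‖u n t‖₊ : ℝ≥0∞)) ≠ ⊤ := ht.ne
    exact Summable.of_nnnorm (ENNReal.tsum_coe_ne_top_iff_summable.1 h1)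
  have hfe : ∀ t, Φ t < ⊤ → g t = q * η (q * t) + q * g (q * t) := by
    intro t ht
    have hs := hsum t ht
    show ∑' n, u n t = q * η (q * t) + q * ∑' n, u n (q * t)
    rw [hs.tsum_eq_zero_add, ← tsum_mul_left]
    congr 1
    · simp [hu]
    · refine tsum_congr fun n => ?_
      simp only [hu]
      have e : q ^ (n + 1 + 1) * t = q ^ (n + 1) * (q * t) := by ring
      rw [e]
      ring
  -- measurability of `g` on `(0, ∞)`
  have hgm : AEStronglyMeasurable g (volume.restrict (Ioi 0)) := by
    refine aestronglyMeasurable_of_tendsto_ae atTop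
      (f := fun N t => ∑ n ∈ Finset.range N, u n t) (fun N => ?_) ?_
    · exact (Finset.aestronglyMeasurable_fun_sum _ fun n _ => hum n).restrict
    · filter_upwards [hΦ_fin] with t ht
      exact (hsum t ht).hasSum.tendsto_sum_nat
  refine ⟨g, hgm, ?_, hKq_top, fun τ hτ => ?_⟩
  · filter_upwards [hΦ_fin] with t ht
    exact hfe t ht
  · calc ∫⁻ t in Ioo 0 τ, ‖g t‖ₑ ^ (3 / 2 : ℝ) ≤ ∫⁻ t in Ioo 0 τ, Φ t ^ (3 / 2 : ℝ) := by
          refine lintegral_mono fun t => ENNReal.rpow_le_rpow ?_ hr0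
          exact enorm_tsum_le_tsum_enorm
      _ ≤ _ := hΦ_bound τ hτ

end TimeCorrection

end PartTwo

section PartThree

variable {E : Type*} [NormedAddCommGroup E] [InnerProductSpace ℝ E] [FiniteDimensional ℝ E]
  [MeasurableSpace E] [BorelSpace E]

/-! ### An exactly DSS representative of an a.e.-DSS pressure -/

section Representative

omit [FiniteDimensional ℝ E] [MeasurableSpace E] [BorelSpace E] in
/-- Composition of the parabolic scalings by integer powers of `c`:
`σ_j ∘ σ_k = σ_{j+k}` for `σ_k(t, x) = (c^{2k} t, c^k x)` (`c ≠ 0`). [folklore] -/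
theorem stAffine_zpow_stAffine_zpow {c : ℝ} (hc : c ≠ 0) (j k : ℤ)
    (z : ℝ × E) :
    stAffine ((c ^ 2) ^ j) (c ^ j) 0 (0 : E) (stAffine ((c ^ 2) ^ k) (c ^ k) 0 (0 : E) z) =
      stAffine ((c ^ 2) ^ (j + k)) (c ^ (j + k)) 0 (0 : E) z := by
  obtain ⟨t, x⟩ := z
  have hc2 : c ^ 2 ≠ 0 := pow_ne_zero 2 hc
  simp only [stAffine_apply, zero_add, smul_smul, ← mul_assoc, ← zpow_add₀ hc2, ← zpow_add₀ hc]

/-- **An exactly `λ`-DSS representative.** If `p : ℝ → E → ℝ` is `λ`-DSS almost everywhere on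
the open upper half space–time, `λ² p(λ² t, λ x) = p(t, x)` for a.e. `(t, x)` with `t > 0`
(`λ > 1`), then there is `p'` which is `λ`-DSS *everywhere* on `ℝ × E`
(`nsRescalePressure λ p' = p'`) and agrees with `p` a.e. on `t > 0`: discard the saturation
of the exceptional null set under the scalings `(t, x) ↦ (λ^{2k} t, λ^k x)`, `k ∈ ℤ` (still
null, and scaling invariant), and set `p' = 0` there and for `t ≤ 0`. [folklore] -/
theorem exists_nsRescalePressure_eq_of_ae {c : ℝ} (hc : 1 < c) {p : ℝ → E → ℝ}
    (hp : ∀ᵐ z ∂((volume : Measure (ℝ × E)).restrict (Ioi (0 : ℝ) ×ˢ (univ : Set E))),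
      nsRescalePressure c p z.1 z.2 = p z.1 z.2) :
    ∃ p' : ℝ → E → ℝ, nsRescalePressure c p' = p' ∧
      ∀ᵐ z ∂((volume : Measure (ℝ × E)).restrict (Ioi (0 : ℝ) ×ˢ (univ : Set E))),
        p' z.1 z.2 = p z.1 z.2 := by
  have hc0 : 0 < c := zero_lt_one.trans hc
  have hcne : c ≠ 0 := hc0.ne'
  have hc2 : 0 < c ^ 2 := by positivity
  set σ : ℤ → ℝ × E → ℝ × E := fun k => stAffine ((c ^ 2) ^ k) (c ^ k) 0 (0 : E) with hσ
  -- the good set and its saturation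
  set G : Set (ℝ × E) := {z | 0 < z.1 → c ^ 2 * p (c ^ 2 * z.1) (c • z.2) = p z.1 z.2} with hG
  have hG_ae : ∀ᵐ z ∂(volume : Measure (ℝ × E)), z ∈ G := by
    have h1 : ∀ᵐ z ∂(volume : Measure (ℝ × E)), z ∈ Ioi (0 : ℝ) ×ˢ (univ : Set E) →
        nsRescalePressure c p z.1 z.2 = p z.1 z.2 :=
      (ae_restrict_iff' (measurableSet_Ioi.prod MeasurableSet.univ)).1 hp
    filter_upwards [h1] with z hz
    intro hz1
    have := hz ⟨hz1, mem_univ _⟩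
    rwa [nsRescalePressure_apply] at this
  set Gs : Set (ℝ × E) := {z | ∀ k : ℤ, σ k z ∈ G} with hGs
  have hGs_ae : ∀ᵐ z ∂(volume : Measure (ℝ × E)), z ∈ Gs := by
    have h1 : ∀ k : ℤ, ∀ᵐ z ∂(volume : Measure (ℝ × E)), σ k z ∈ G := fun k =>
      (quasiMeasurePreserving_stAffine (zpow_pos hc2 k) (zpow_pos hc0 k) 0 (0 : E)).ae hG_ae
    filter_upwards [ae_all_iff.2 h1] with z hz
    exact hz
  -- invariance of the saturation under the unit scalings
  have hinv : ∀ (z : ℝ × E) (m : ℤ), z ∈ Gs → σ m z ∈ Gs := by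
    intro z m hz k
    have e : σ k (σ m z) = σ (k + m) z := stAffine_zpow_stAffine_zpow hcne k m z
    show σ k (σ m z) ∈ G
    rw [e]
    exact hz (k + m)
  have hσ1 : ∀ t x, σ 1 (t, x) = (c ^ 2 * t, c • x) := by
    intro t x
    simp [hσ, stAffine_apply]
  have hσneg : ∀ t x, σ (-1) (c ^ 2 * t, c • x) = (t, x) := by
    intro t x
    simp only [hσ, stAffine_apply, zero_add, zpow_neg_one, smul_smul, ← mul_assoc,
      inv_mul_cancel₀ hc2.ne', inv_mul_cancel₀ hcne, one_mul, one_smul]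
  have hσ0 : ∀ z, σ 0 z = z := by
    rintro ⟨t, x⟩
    simp [hσ, stAffine_apply]
  -- the representative
  classical
  set p' : ℝ → E → ℝ := fun t x => if (t, x) ∈ Gs ∧ 0 < t then p t x else 0 with hp'
  refine ⟨p', ?_, ?_⟩
  · funext t x
    rw [nsRescalePressure_apply]
    by_cases h : (t, x) ∈ Gs ∧ 0 < t
    · obtain ⟨h1, h2⟩ := h
      have h3 : (c ^ 2 * t, c • x) ∈ Gs := by
        rw [← hσ1]
        exact hinv _ 1 h1
      have h4 : 0 < c ^ 2 * t := mul_pos hc2 h2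
      have h5 : (t, x) ∈ G := by
        have := h1 0
        rwa [hσ0] at this
      have e1 : p' (c ^ 2 * t) (c • x) = p (c ^ 2 * t) (c • x) := if_pos ⟨h3, h4⟩
      have e2 : p' t x = p t x := if_pos ⟨h1, h2⟩
      rw [e1, e2]
      exact h5 h2
    · have e2 : p' t x = 0 := if_neg h
      have h' : ¬ ((c ^ 2 * t, c • x) ∈ Gs ∧ 0 < c ^ 2 * t) := by
        rintro ⟨h1, h2⟩
        refine h ⟨?_, (mul_pos_iff_of_pos_left hc2).1 h2⟩
        rw [← hσneg t x]
        exact hinv _ (-1) h1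
      have e1 : p' (c ^ 2 * t) (c • x) = 0 := if_neg h'
      rw [e1, e2, mul_zero]
  · have h1 : ∀ᵐ z ∂((volume : Measure (ℝ × E)).restrict (Ioi (0 : ℝ) ×ˢ (univ : Set E))),
        z ∈ Ioi (0 : ℝ) ×ˢ (univ : Set E) :=
      ae_restrict_mem (measurableSet_Ioi.prod MeasurableSet.univ)
    filter_upwards [h1, ae_restrict_of_ae hGs_ae] with z hz1 hz2
    exact if_pos ⟨hz2, hz1.1⟩

end Representative

/-! ### Suitable weak solutions: a.e. modification of the pressure -/

section CongrPressure

variable {Q : Opens (ℝ × E)} {ν : ℝ} {f u : ℝ → E → E} {p p' : ℝ → E → ℝ}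

/-- **The pressure of a suitable weak solution may be modified on a null set.** If `(u, p)` is a
suitable weak solution on `Q` (Caffarelli–Kohn–Nirenberg 1982, (2.1)–(2.5)) and `p' = p` a.e. on
`Q`, then `(u, p')` is a suitable weak solution on `Q`: all occurrences of the pressure are under
integrals over `Q` (for the iterated integral of the local energy inequality, the integrands
agree a.e. on `ℝ × E` since the test function's gradient vanishes off `Q`). [folklore] -/
theorem IsSuitableWeakSolutionOn.congr_pressure_ae (h : IsSuitableWeakSolutionOn Q ν f u p)
    (hpp' : ∀ᵐ z ∂((volume : Measure (ℝ × E)).restrict (Q : Set (ℝ × E))),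
      p' z.1 z.2 = p z.1 z.2) :
    IsSuitableWeakSolutionOn Q ν f u p' := by
  obtain ⟨hu, hu2, hp, hdiv, hmom⟩ := h.distributional
  obtain ⟨G, hG, hG2, hloc⟩ := h.localEnergy
  have hae : ∀ᵐ z ∂(volume : Measure (ℝ × E)), z ∈ (Q : Set (ℝ × E)) → p' z.1 z.2 = p z.1 z.2 :=
    (ae_restrict_iff' Q.isOpen.measurableSet).1 hpp'
  refine
    { distributional := ⟨hu, hu2, ?_, hdiv, fun ψ hψ => ?_⟩
      energyClass := h.energyClass
      pressure := ?_
      localEnergy := ⟨G, hG, hG2, fun φ hφ hφ0 => ?_⟩ }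
  · intro z hz
    obtain ⟨U, hU, hpU⟩ := hp z hz
    refine ⟨U ∩ (Q : Set (ℝ × E)), inter_mem hU self_mem_nhdsWithin, ?_⟩
    have hpU' : IntegrableOn (uncurry p) (U ∩ (Q : Set (ℝ × E))) volume :=
      hpU.mono_set inter_subset_left
    refine hpU'.congr_fun_ae ?_
    have h1 : ∀ᵐ z ∂((volume : Measure (ℝ × E)).restrict (U ∩ (Q : Set (ℝ × E)))),
        p' z.1 z.2 = p z.1 z.2 :=
      ae_restrict_of_ae_restrict_of_subset inter_subset_right hpp'
    filter_upwards [h1] with z hz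
    exact hz.symm
  · have key := hmom ψ hψ
    rw [← key]
    refine integral_congr_ae ?_
    filter_upwards [hpp'] with z hz
    rw [hz]
  · intro K hK hKc
    have h1 : ∀ᵐ z ∂((volume : Measure (ℝ × E)).restrict K), p' z.1 z.2 = p z.1 z.2 :=
      ae_restrict_of_ae_restrict_of_subset hK hpp'
    calc ∫⁻ z in K, ‖p' z.1 z.2‖ₑ ^ (3 / 2 : ℝ) = ∫⁻ z in K, ‖p z.1 z.2‖ₑ ^ (3 / 2 : ℝ) :=
          lintegral_congr_ae (by
            filter_upwards [h1] with z hz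
            rw [hz])
      _ < ⊤ := h.pressure K hK hKc
  · have key := hloc φ hφ hφ0
    obtain ⟨-, -, hw0⟩ := hφ.continuous_gradient_field
    have hint : ∫ t, ∫ x, (‖u t x‖ ^ 2 * (timeDeriv φ t x + ν * Δ (φ t) x) +
          (‖u t x‖ ^ 2 + 2 * p' t x) * ⟪u t x, gradient (φ t) x⟫ +
          2 * ⟪f t x, u t x⟫ * φ t x) =
        ∫ t, ∫ x, (‖u t x‖ ^ 2 * (timeDeriv φ t x + ν * Δ (φ t) x) +
          (‖u t x‖ ^ 2 + 2 * p t x) * ⟪u t x, gradient (φ t) x⟫ +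
          2 * ⟪f t x, u t x⟫ * φ t x) := by
      refine integral_integral_congr_ae_prod ?_
      filter_upwards [hae] with z hz
      by_cases hzQ : z ∈ (Q : Set (ℝ × E))
      · rw [hz hzQ]
      · have h0 : gradient (φ z.1) z.2 = 0 := hw0 z fun h' => hzQ (hφ.tsupport_subset h')
        rw [h0, inner_zero_right, mul_zero, mul_zero]
    rw [hint]
    exact key

end CongrPressure

/-! ### Two pressures for one velocity have the same gradient -/

section PressureGradient

/-- The quadratic pairing `⟪u, A u⟫` of a field with `u, |u|² ∈ L¹_loc(Q)` against a continuous
operator field supported in a compact subset of `Q` is integrable on the whole space–time. [folklore] -/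
theorem integrable_inner_clm_apply_of_locallyIntegrableOn_sq {Q : Opens (ℝ × E)} {u : ℝ → E → E}
    (hu : LocallyIntegrableOn (uncurry u) (Q : Set (ℝ × E)) volume)
    (hu2 : LocallyIntegrableOn (fun z => ‖uncurry u z‖ ^ 2) (Q : Set (ℝ × E)) volume)
    {A : ℝ × E → E →L[ℝ] E} (hA : Continuous A) {K : Set (ℝ × E)} (hK : IsCompact K)
    (hKQ : K ⊆ (Q : Set (ℝ × E))) (hAK : ∀ z ∉ K, A z = 0) :
    Integrable (fun z : ℝ × E => ⟪u z.1 z.2, A z (u z.1 z.2)⟫) (volume : Measure (ℝ × E)) := by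
  have huK : IntegrableOn (uncurry u) K volume := hu.integrableOn_compact_subset hKQ hK
  have hu2K : IntegrableOn (fun z => ‖uncurry u z‖ ^ 2) K volume :=
    hu2.integrableOn_compact_subset hKQ hK
  have hAc : HasCompactSupport A := HasCompactSupport.intro hK hAK
  obtain ⟨C, hC⟩ := hA.bounded_above_of_compact_support hAc
  have hsupp : support (fun z : ℝ × E => ⟪u z.1 z.2, A z (u z.1 z.2)⟫) ⊆ K := by
    intro z hz
    by_contra hzK
    exact hz (by simp [hAK z hzK])
  refine (integrableOn_iff_integrable_of_support_subset hsupp).1 ?_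
  have hm : AEStronglyMeasurable (fun z : ℝ × E => ⟪u z.1 z.2, A z (u z.1 z.2)⟫)
      ((volume : Measure (ℝ × E)).restrict K) :=
    huK.1.inner (isBoundedBilinearMap_apply.continuous.comp_aestronglyMeasurable
      (hA.aestronglyMeasurable.prodMk huK.1))
  refine Integrable.mono' (hu2K.const_mul C) hm ?_
  filter_upwards with z
  calc ‖⟪u z.1 z.2, A z (u z.1 z.2)⟫‖ ≤ ‖u z.1 z.2‖ * ‖A z (u z.1 z.2)‖ := norm_inner_le_norm _ _
    _ ≤ ‖u z.1 z.2‖ * (C * ‖u z.1 z.2‖) := by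
        gcongr
        exact (ContinuousLinearMap.le_opNorm _ _).trans
          (mul_le_mul_of_nonneg_right (hC z) (norm_nonneg _))
    _ = C * ‖uncurry u z‖ ^ 2 := by
        simp only [uncurry]
        ring

/-- **Two pressures for one velocity have the same gradient.** If `(u, p₁)` and `(u, p₂)` are
distributional solutions of the unforced Navier–Stokes system on the open region `Q`
(Caffarelli–Kohn–Nirenberg 1982, (2.2)), then `∫∫_Q (p₂ - p₁) ∂_w θ = 0` for every scalar test
function `θ ∈ C_c^∞(Q)` and every direction `w`, i.e. `∇(p₂ - p₁) = 0` in `𝒟'(Q)`: test both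
momentum equations with the field `θ w` (whose velocity terms are integrable, so that the two
identities may be subtracted) and use `div (θ w) = ∂_w θ`. [cite: CaffarelliKohnNirenberg1982, §2 (2.2)] -/
theorem IsDistributionalNSSolutionOn.integral_sub_mul_fderiv_eq_zero {Q : Opens (ℝ × E)}
    {ν : ℝ} {u : ℝ → E → E} {p₁ p₂ : ℝ → E → ℝ}
    (h₁ : IsDistributionalNSSolutionOn Q ν 0 u p₁) (h₂ : IsDistributionalNSSolutionOn Q ν 0 u p₂)
    {θ : ℝ → E → ℝ} (hθ : IsSpaceTimeTestOn Q θ) (w : E) :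
    ∫ z in (Q : Set (ℝ × E)), (p₂ z.1 z.2 - p₁ z.1 z.2) * fderiv ℝ (θ z.1) z.2 w = 0 := by
  obtain ⟨hu, hu2, hp₁, -, hmom₁⟩ := h₁
  obtain ⟨-, -, hp₂, -, hmom₂⟩ := h₂
  -- the vector test field `θ w`
  set ψ : ℝ → E → E := fun t x => θ t x • w with hψdef
  have hψu : uncurry ψ = fun z => uncurry θ z • w := rfl
  have hψ : IsSpaceTimeTestOn Q ψ := by
    refine ⟨?_, ?_, ?_⟩
    · rw [hψu]
      exact hθ.contDiff.smul contDiff_const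
    · rw [hψu]
      exact hθ.hasCompactSupport.smul_right (f' := fun _ : ℝ × E => w)
    · rw [hψu]
      exact (tsupport_smul_subset_left (uncurry θ) (fun _ : ℝ × E => w)).trans hθ.tsupport_subset
  set K := tsupport (uncurry ψ) with hK
  have hKc : IsCompact K := hψ.hasCompactSupport
  have hKQ : K ⊆ (Q : Set (ℝ × E)) := hψ.tsupport_subset
  have hψ' : IsSpaceTimeTestOn (⊤ : Opens (ℝ × E)) ψ := hψ.mono le_top
  -- integrability of the velocity terms
  have hIt : Integrable (fun z : ℝ × E => ⟪u z.1 z.2, timeDeriv ψ z.1 z.2⟫)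
      (volume : Measure (ℝ × E)) :=
    integrable_inner_of_locallyIntegrableOn hu (w := fun z => timeDeriv ψ z.1 z.2)
      hψ'.timeDeriv_top.contDiff.continuous hKc hKQ
      (fun z hz => IsSpaceTimeTestOn.timeDeriv_eq_zero_of_notMem hz)
  have hIc : Integrable (fun z : ℝ × E => ⟪u z.1 z.2, convect (u z.1) (ψ z.1) z.2⟫)
      (volume : Measure (ℝ × E)) :=
    integrable_inner_clm_apply_of_locallyIntegrableOn_sq hu hu2 (A := fun z => fderiv ℝ (ψ z.1) z.2)
      hψ'.fderiv_top.contDiff.continuous hKc hKQ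
      (fun z hz => IsSpaceTimeTestOn.fderiv_slice_eq_zero_of_notMem hz)
  have hIl : Integrable (fun z : ℝ × E => ν * ⟪u z.1 z.2, Δ (ψ z.1) z.2⟫)
      (volume : Measure (ℝ × E)) :=
    (integrable_inner_of_locallyIntegrableOn hu (w := fun z => Δ (ψ z.1) z.2)
      hψ'.laplacian_top.contDiff.continuous hKc hKQ
      (fun z hz => laplacian_slice_eq_zero_of_notMem_tsupport hz)).const_mul ν
  obtain ⟨hdc, hd0⟩ := hψ.continuous_divergence_field
  have hIp₁ : Integrable (fun z : ℝ × E => p₁ z.1 z.2 * VectorCalculus.divergence (ψ z.1) z.2)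
      (volume : Measure (ℝ × E)) :=
    integrable_mul_of_locallyIntegrableOn hp₁ hdc hKc hKQ hd0
  have hIp₂ : Integrable (fun z : ℝ × E => p₂ z.1 z.2 * VectorCalculus.divergence (ψ z.1) z.2)
      (volume : Measure (ℝ × E)) :=
    integrable_mul_of_locallyIntegrableOn hp₂ hdc hKc hKQ hd0
  set U : ℝ × E → ℝ := fun z => ⟪u z.1 z.2, timeDeriv ψ z.1 z.2⟫ +
    ⟪u z.1 z.2, convect (u z.1) (ψ z.1) z.2⟫ + ν * ⟪u z.1 z.2, Δ (ψ z.1) z.2⟫ with hU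
  have hIU : Integrable U (volume : Measure (ℝ × E)) := (hIt.add hIc).add hIl
  have hI₁ : Integrable (fun z : ℝ × E => U z + p₁ z.1 z.2 * VectorCalculus.divergence (ψ z.1) z.2)
      (volume : Measure (ℝ × E)) := hIU.add hIp₁
  have hI₂ : Integrable (fun z : ℝ × E => U z + p₂ z.1 z.2 * VectorCalculus.divergence (ψ z.1) z.2)
      (volume : Measure (ℝ × E)) := hIU.add hIp₂
  have e₁ : ∫ z in (Q : Set (ℝ × E)),
      (U z + p₁ z.1 z.2 * VectorCalculus.divergence (ψ z.1) z.2) = 0 := by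
    have := hmom₁ ψ hψ
    simpa only [hU, Pi.zero_apply, inner_zero_left, add_zero] using this
  have e₂ : ∫ z in (Q : Set (ℝ × E)),
      (U z + p₂ z.1 z.2 * VectorCalculus.divergence (ψ z.1) z.2) = 0 := by
    have := hmom₂ ψ hψ
    simpa only [hU, Pi.zero_apply, inner_zero_left, add_zero] using this
  have hsub : ∫ z in (Q : Set (ℝ × E)),
      ((U z + p₂ z.1 z.2 * VectorCalculus.divergence (ψ z.1) z.2) -
        (U z + p₁ z.1 z.2 * VectorCalculus.divergence (ψ z.1) z.2)) = 0 := by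
    rw [integral_sub hI₂.integrableOn hI₁.integrableOn, e₁, e₂, sub_zero]
  have e3 : ∀ z : ℝ × E,
      (U z + p₂ z.1 z.2 * VectorCalculus.divergence (ψ z.1) z.2) -
        (U z + p₁ z.1 z.2 * VectorCalculus.divergence (ψ z.1) z.2) =
      (p₂ z.1 z.2 - p₁ z.1 z.2) * fderiv ℝ (θ z.1) z.2 w := by
    intro z
    have hd : DifferentiableAt ℝ (θ z.1) z.2 :=
      ((hθ.contDiff_slice z.1).differentiable (by simp)).differentiableAt
    have hdv : VectorCalculus.divergence (ψ z.1) z.2 = fderiv ℝ (θ z.1) z.2 w :=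
      divergence_smul_const w hd
    rw [hdv]
    ring
  simp_rw [e3] at hsub
  exact hsub

end PressureGradient

/-! ### The rescaled pressure of a DSS velocity is again a pressure -/

section RescaledPressure

omit [FiniteDimensional ℝ E] [MeasurableSpace E] [BorelSpace E] in
/-- The rescaled pressure in the `stPull` notation: `λ² p(λ² s, λ y) = nsRescalePressure λ p`. [folklore] -/
theorem sq_smul_stPull_eq_nsRescalePressure (c : ℝ) (p : ℝ → E → ℝ) :
    c ^ 2 • stPull (c * c) c 0 (0 : E) p = nsRescalePressure c p := by
  funext t x
  have e : (c ^ 2 • stPull (c * c) c 0 (0 : E) p) t x = c ^ 2 * p (0 + c * c * t) (0 + c • x) :=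
    rfl
  rw [e, zero_add, zero_add, nsRescalePressure_apply, sq]

omit [FiniteDimensional ℝ E] [MeasurableSpace E] [BorelSpace E] in
/-- The open upper half space–time is invariant under the parabolic scalings (`c > 0`). [folklore] -/
theorem stPreimage_parabolic_slab_Ioi {c : ℝ} (hc : 0 < c) :
    stPreimage (c * c) c 0 (0 : E) (slab E (Ioi 0) isOpen_Ioi) = slab E (Ioi 0) isOpen_Ioi := by
  ext z
  simp only [SetLike.mem_coe, mem_stPreimage, mem_slab, stAffine_fst, zero_add, mem_Ioi]
  exact mul_pos_iff_of_pos_left (mul_pos hc hc)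

/-- **The rescaled pressure of a DSS velocity is again a pressure for it.** If `(u, p)` is a
suitable weak solution of the unforced Navier–Stokes system (`ν = 1`) on `(0, ∞) × E` and `u` is
`λ`-DSS, then `(u, λ² p(λ²·, λ·))` is a suitable weak solution on `(0, ∞) × E` as well: the
Navier–Stokes rescaling of `(u, p)` by `λ` is a suitable weak solution
(`IsSuitableWeakSolutionOn.stRescale`, CKN 1982, §2) whose velocity is `u` itself.
[cite: CaffarelliKohnNirenberg1982, §2] -/
theorem IsSuitableWeakSolutionOn.nsRescalePressure_of_isDiscretelySelfSimilar {c : ℝ}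
    (hc : 0 < c) {u : ℝ → E → E} {p : ℝ → E → ℝ}
    (h : IsSuitableWeakSolutionOn (slab E (Ioi 0) isOpen_Ioi) 1 0 u p)
    (hu : IsDiscretelySelfSimilar c u) :
    IsSuitableWeakSolutionOn (slab E (Ioi 0) isOpen_Ioi) 1 0 u (nsRescalePressure c p) := by
  have h1 := h.stRescale (α := c) (β := c * c) (γ := c) hc hc rfl 0 (0 : E)
  rw [BradshawTsai2019.smul_stPull_eq_self hu, mul_one, div_self hc.ne',
    sq_smul_stPull_eq_nsRescalePressure, stPreimage_parabolic_slab_Ioi hc] at h1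
  have hf : ((c ^ 2 * c) • stPull (c * c) c 0 (0 : E) (0 : ℝ → E → E)) = 0 := by
    funext t x
    simp
  rwa [hf] at h1

end RescaledPressure

end PartThree

/-! ### Auxiliary integral identities -/

section AuxIntegrals

variable {X : Type*} [MeasureSpace X] [SFinite (volume : Measure X)]

/-- Lower integrals of functions of time alone over cylinders: `∫_{A × B} G(t) = (∫_A G) |B|`. [folklore] -/
theorem setLIntegral_prod_comp_fst (A : Set ℝ) (B : Set X)
    {G : ℝ → ℝ≥0∞} (hG : AEMeasurable G (volume.restrict A)) :
    ∫⁻ z in A ×ˢ B, G z.1 = (∫⁻ t in A, G t) * volume B := by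
  rw [Measure.volume_eq_prod, ← Measure.prod_restrict]
  have e : (fun z : ℝ × X => G z.1) = fun z => G z.1 * (fun _ : X => (1 : ℝ≥0∞)) z.2 := by
    funext z
    simp
  rw [e, lintegral_prod_mul hG aemeasurable_const, lintegral_const, Measure.restrict_apply_univ,
    one_mul]

end AuxIntegrals

section AuxTime

/-- A.e. statements on `(0, ∞)` are preserved under `t ↦ a t`, `a > 0`. [folklore] -/
theorem ae_restrict_Ioi_comp_mul_left {a : ℝ} (ha : 0 < a) {P : ℝ → Prop}
    (h : ∀ᵐ s ∂((volume : Measure ℝ).restrict (Ioi 0)), P s) :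
    ∀ᵐ t ∂((volume : Measure ℝ).restrict (Ioi 0)), P (a * t) := by
  rw [ae_restrict_iff' measurableSet_Ioi] at h ⊢
  filter_upwards [(quasiMeasurePreserving_mul_left ha.ne').ae h] with t ht
  intro ht0
  exact ht (mul_pos ha ht0)

/-- An `L^{3/2}` function on a bounded time interval is integrable there. [folklore] -/
theorem integrableOn_Ioo_of_lintegral_rpow_lt_top {g : ℝ → ℝ} {a b : ℝ}
    (hgm : AEStronglyMeasurable g ((volume : Measure ℝ).restrict (Ioo a b)))
    (hg : ∫⁻ t in Ioo a b, ‖g t‖ₑ ^ (3 / 2 : ℝ) < ⊤) : IntegrableOn g (Ioo a b) volume := by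
  have hp0 : ENNReal.ofReal (3 / 2) ≠ 0 := by simp
  have hmem : MemLp g (ENNReal.ofReal (3 / 2)) ((volume : Measure ℝ).restrict (Ioo a b)) := by
    refine ⟨hgm, ?_⟩
    rw [eLpNorm_lt_top_iff_lintegral_rpow_enorm_lt_top hp0 ENNReal.ofReal_ne_top,
      ENNReal.toReal_ofReal (by norm_num)]
    exact hg
  exact hmem.integrable (ENNReal.one_le_ofReal.2 (by norm_num))

end AuxTime

/-! ### DSS local Leray solutions admit DSS pressures -/

section DSSPressure

/-- The `L^{3/2}`-mass of the rescaled pressure `λ² p(λ²·, λ·)` on a cylinder at the origin is a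
multiple of the mass of `p` on the scaled cylinder (change of variables). [folklore] -/
theorem setLIntegral_cylinder_nsRescalePressure {c : ℝ} (hc : 0 < c) (p : ℝ → (EuclideanSpace ℝ (Fin 3)) → ℝ) (T r : ℝ) :
    ∫⁻ z in Ioo 0 ((c * c)⁻¹ * T) ×ˢ ball (0 : (EuclideanSpace ℝ (Fin 3))) (c⁻¹ * r),
        ‖nsRescalePressure c p z.1 z.2‖ₑ ^ (3 / 2 : ℝ) =
      ‖c ^ 2‖ₑ ^ (3 / 2 : ℝ) * ENNReal.ofReal (c * c * c ^ 3)⁻¹ *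
        ∫⁻ z in Ioo 0 T ×ˢ ball (0 : (EuclideanSpace ℝ (Fin 3))) r, ‖p z.1 z.2‖ₑ ^ (3 / 2 : ℝ) := by
  have hpre : stAffine (c * c) c 0 (0 : (EuclideanSpace ℝ (Fin 3))) ⁻¹' (Ioo 0 T ×ˢ ball (0 : (EuclideanSpace ℝ (Fin 3))) r) =
      Ioo 0 ((c * c)⁻¹ * T) ×ˢ ball (0 : (EuclideanSpace ℝ (Fin 3))) (c⁻¹ * r) := by
    rw [stAffine_preimage_cylinder (mul_pos hc hc) hc]
    simp only [sub_zero, zero_div, smul_zero]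
    rw [div_eq_inv_mul, div_eq_inv_mul]
  rw [← hpre, ← sq_smul_stPull_eq_nsRescalePressure,
    setLIntegral_enorm_rpow_stRescale (mul_pos hc hc) hc 0 (0 : (EuclideanSpace ℝ (Fin 3))) (c ^ 2) p _ (by norm_num),
    finrank_euclideanSpace_fin]

/-- **A DSS local Leray solution admits a DSS pressure** (the normalisation freedom of the
pressure, used in Bradshaw–Tsai 2019, proof of Prop. 3.1, p. 9: "Since the only appearance of
`π_ε` in (3.5) is `∇π_ε`, we can re-define `π_ε` to equal `π_ε − π_*(t)`"). Fix `λ > 1`. There is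
a constant `K = K(λ) < ∞` such that for every local Leray solution `(v, π)` of the unforced
Navier–Stokes equations (`ν = 1`) whose velocity `v` is `λ`-DSS there is a pressure `π'` with
`(v, π')` again a local Leray solution with the same datum, `π'` `λ`-DSS *everywhere*
(`λ² π'(λ² t, λ x) = π'(t, x)` on `ℝ × ℝ³`), and
`∫₀ᵀ∫_{B₁} |π'|^{3/2} ≤ K ∫₀ᵀ∫_{B₁} |π|^{3/2}` for every `T > 0`. Construction: `λ² π(λ²·, λ·)`
is also a pressure for `v` (`IsSuitableWeakSolutionOn.nsRescalePressure_of_isDiscretelySelfSimilar`),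
so `λ² π(λ² t, λ x) − π(t, x) = η(t)` is a function of time alone
(`∇(p₂ − p₁) = 0`, `exists_ae_eq_comp_fst_of_forall_integral_mul_fderiv_eq_zero`); subtract from
`π` the unique solution `g ∈ L^{3/2}_loc([0, ∞))` of `g(t) − λ⁻² g(λ⁻² t) = λ⁻² η(λ⁻² t)`
(`exists_time_correction`, a convergent series along the scaling orbit towards `t = 0`), which
keeps `(v, π − g)` a local Leray solution (`IsSuitableWeakSolutionOn.sub_pressure`) and makes it
a.e. `λ`-DSS; finally pass to an exactly DSS representative
(`exists_nsRescalePressure_eq_of_ae`). The constant only involves `λ`, the volumes of `B₁`,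
`B_{1/λ}` and `Σ_n λ^{-2n/3}`. [cite: BradshawTsai2019, proof of Prop 3.1 (normalisation of the pressure, arXiv p. 9)] -/
theorem IsLocalLeraySolution.exists_dss_pressure {c : ℝ} (hc : 1 < c) :
    ∃ K : ℝ≥0∞, K < ⊤ ∧ ∀ {v₀ : (EuclideanSpace ℝ (Fin 3)) → (EuclideanSpace ℝ (Fin 3))} {v : ℝ → (EuclideanSpace ℝ (Fin 3)) → (EuclideanSpace ℝ (Fin 3))} {π : ℝ → (EuclideanSpace ℝ (Fin 3)) → ℝ},
      IsLocalLeraySolution 1 v₀ v π → IsDiscretelySelfSimilar c v →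
      ∃ π' : ℝ → (EuclideanSpace ℝ (Fin 3)) → ℝ, IsLocalLeraySolution 1 v₀ v π' ∧ nsRescalePressure c π' = π' ∧
        ∀ T : ℝ, 0 < T →
          ∫⁻ z in Ioo 0 T ×ˢ ball (0 : (EuclideanSpace ℝ (Fin 3))) 1, ‖π' z.1 z.2‖ₑ ^ (3 / 2 : ℝ) ≤
            K * ∫⁻ z in Ioo 0 T ×ˢ ball (0 : (EuclideanSpace ℝ (Fin 3))) 1, ‖π z.1 z.2‖ₑ ^ (3 / 2 : ℝ) := by
  have hc0 : 0 < c := zero_lt_one.trans hc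
  have hcne : c ≠ 0 := hc0.ne'
  have hc2 : 0 < c ^ 2 := by positivity
  have hr0 : (0 : ℝ) ≤ 3 / 2 := by norm_num
  -- the ratio `q = λ⁻²` and the constants
  set q : ℝ := (c ^ 2)⁻¹ with hq
  have hq0 : 0 < q := inv_pos.2 hc2
  have hq1 : q < 1 := inv_lt_one_of_one_lt₀ (one_lt_pow₀ hc two_ne_zero)
  have hqc : q * c ^ 2 = 1 := inv_mul_cancel₀ hc2.ne'
  have hcc : c * c = c ^ 2 := (sq c).symm
  set Kq : ℝ≥0∞ := ∑' n : ℕ, ENNReal.ofReal (q ^ (1 / 3 : ℝ)) ^ (n + 1) with hKq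
  -- finiteness of `Kq` (from the time-correction lemma applied to `η = 0`)
  have hKq_top : Kq ≠ ⊤ := by
    obtain ⟨-, -, -, h, -⟩ := exists_time_correction hq0 hq1 (η := fun _ => (0 : ℝ))
      aestronglyMeasurable_const (fun τ _ => by simp [ENNReal.zero_rpow_of_pos])
    exact h
  set A : ℝ≥0∞ := ‖c ^ 2‖ₑ ^ (3 / 2 : ℝ) * ENNReal.ofReal (c * c * c ^ 3)⁻¹ with hA
  have hA_top : A ≠ ⊤ :=
    ENNReal.mul_ne_top (ENNReal.rpow_ne_top_of_nonneg hr0 enorm_ne_top) ENNReal.ofReal_ne_top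
  set B : Set (EuclideanSpace ℝ (Fin 3)) := ball (0 : (EuclideanSpace ℝ (Fin 3))) c⁻¹ with hB
  have hB0 : volume B ≠ 0 := (measure_ball_pos volume _ (inv_pos.2 hc0)).ne'
  have hBtop : volume B ≠ ⊤ := measure_ball_lt_top.ne
  have hB1top : volume (ball (0 : (EuclideanSpace ℝ (Fin 3))) 1) ≠ ⊤ := measure_ball_lt_top.ne
  set two : ℝ≥0∞ := (2 : ℝ≥0∞) ^ ((3 / 2 : ℝ) - 1) with htwo
  have htwo_top : two ≠ ⊤ := ENNReal.rpow_ne_top_of_nonneg (by norm_num) (by simp)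
  set K : ℝ≥0∞ := two * (1 + volume (ball (0 : (EuclideanSpace ℝ (Fin 3))) 1) * (Kq ^ (3 / 2 : ℝ) *
    ((volume B)⁻¹ * (two * (A + 1))))) with hK
  have hK_top : K < ⊤ := by
    refine ENNReal.mul_lt_top htwo_top.lt_top (ENNReal.add_lt_top.2 ⟨ENNReal.one_lt_top, ?_⟩)
    refine ENNReal.mul_lt_top hB1top.lt_top (ENNReal.mul_lt_top ?_ (ENNReal.mul_lt_top ?_ ?_))
    · exact (ENNReal.rpow_ne_top_of_nonneg hr0 hKq_top).lt_top
    · exact (ENNReal.inv_ne_top.2 hB0).lt_top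
    · exact ENNReal.mul_lt_top htwo_top.lt_top
        (ENNReal.add_lt_top.2 ⟨hA_top.lt_top, ENNReal.one_lt_top⟩)
  -- the elementary `L^{3/2}` triangle inequality
  have htri : ∀ (S : Set (ℝ × (EuclideanSpace ℝ (Fin 3)))) (a b : ℝ → (EuclideanSpace ℝ (Fin 3)) → ℝ),
      AEMeasurable (fun z : ℝ × (EuclideanSpace ℝ (Fin 3)) => ‖a z.1 z.2‖ₑ ^ (3 / 2 : ℝ)) (volume.restrict S) →
      ∫⁻ z in S, ‖a z.1 z.2 - b z.1 z.2‖ₑ ^ (3 / 2 : ℝ) ≤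
        two * ((∫⁻ z in S, ‖a z.1 z.2‖ₑ ^ (3 / 2 : ℝ)) + ∫⁻ z in S, ‖b z.1 z.2‖ₑ ^ (3 / 2 : ℝ)) := by
    intro S a b ham
    have hle : ∀ z : ℝ × (EuclideanSpace ℝ (Fin 3)), ‖a z.1 z.2 - b z.1 z.2‖ₑ ^ (3 / 2 : ℝ) ≤
        two * (‖a z.1 z.2‖ₑ ^ (3 / 2 : ℝ) + ‖b z.1 z.2‖ₑ ^ (3 / 2 : ℝ)) := by
      intro z
      calc ‖a z.1 z.2 - b z.1 z.2‖ₑ ^ (3 / 2 : ℝ)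
          ≤ (‖a z.1 z.2‖ₑ + ‖b z.1 z.2‖ₑ) ^ (3 / 2 : ℝ) := by
            gcongr
            exact enorm_sub_le
        _ ≤ two * (‖a z.1 z.2‖ₑ ^ (3 / 2 : ℝ) + ‖b z.1 z.2‖ₑ ^ (3 / 2 : ℝ)) :=
            ENNReal.rpow_add_le_mul_rpow_add_rpow _ _ (by norm_num)
    calc ∫⁻ z in S, ‖a z.1 z.2 - b z.1 z.2‖ₑ ^ (3 / 2 : ℝ)
        ≤ ∫⁻ z in S, two * (‖a z.1 z.2‖ₑ ^ (3 / 2 : ℝ) + ‖b z.1 z.2‖ₑ ^ (3 / 2 : ℝ)) :=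
          lintegral_mono fun z => hle z
      _ = two * ((∫⁻ z in S, ‖a z.1 z.2‖ₑ ^ (3 / 2 : ℝ)) +
            ∫⁻ z in S, ‖b z.1 z.2‖ₑ ^ (3 / 2 : ℝ)) := by
          rw [lintegral_const_mul' _ _ htwo_top, lintegral_add_left' ham]
  refine ⟨K, hK_top, fun {v₀ v π} hsol hdss => ?_⟩
  -- the slab, the two pressures and their difference
  set Q : Opens (ℝ × (EuclideanSpace ℝ (Fin 3))) := slab (EuclideanSpace ℝ (Fin 3)) (Ioi 0) isOpen_Ioi with hQ
  have hQcoe : (Q : Set (ℝ × (EuclideanSpace ℝ (Fin 3)))) = Ioi (0 : ℝ) ×ˢ (univ : Set (EuclideanSpace ℝ (Fin 3))) := rfl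
  have hsw : IsSuitableWeakSolutionOn Q 1 0 v π := hsol.suitable
  set πc : ℝ → (EuclideanSpace ℝ (Fin 3)) → ℝ := nsRescalePressure c π with hπc
  have hswc : IsSuitableWeakSolutionOn Q 1 0 v πc :=
    hsw.nsRescalePressure_of_isDiscretelySelfSimilar hc0 hdss
  have hpli : LocallyIntegrableOn (uncurry π) (Q : Set (ℝ × (EuclideanSpace ℝ (Fin 3)))) volume :=
    hsw.distributional.2.2.1
  have hpcli : LocallyIntegrableOn (uncurry πc) (Q : Set (ℝ × (EuclideanSpace ℝ (Fin 3)))) volume :=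
    hswc.distributional.2.2.1
  have hpm : AEStronglyMeasurable (uncurry π) (volume.restrict (Q : Set (ℝ × (EuclideanSpace ℝ (Fin 3))))) :=
    hpli.aestronglyMeasurable
  have hpcm : AEStronglyMeasurable (uncurry πc) (volume.restrict (Q : Set (ℝ × (EuclideanSpace ℝ (Fin 3))))) :=
    hpcli.aestronglyMeasurable
  set F : ℝ → (EuclideanSpace ℝ (Fin 3)) → ℝ := fun t x => πc t x - π t x with hF
  have hFli : LocallyIntegrableOn (uncurry F) (Q : Set (ℝ × (EuclideanSpace ℝ (Fin 3)))) volume := by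
    have e : uncurry F = uncurry πc - uncurry π := rfl
    rw [e]
    exact hpcli.sub hpli
  have hF0 : ∀ θ : ℝ → (EuclideanSpace ℝ (Fin 3)) → ℝ, IsSpaceTimeTestOn Q θ → ∀ w : (EuclideanSpace ℝ (Fin 3)),
      ∫ z in (Q : Set (ℝ × (EuclideanSpace ℝ (Fin 3)))), F z.1 z.2 * fderiv ℝ (θ z.1) z.2 w = 0 := fun θ hθ w =>
    hsw.distributional.integral_sub_mul_fderiv_eq_zero hswc.distributional hθ w
  -- Step 1: `F` is a function of time
  obtain ⟨η, hηm, hFη⟩ :=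
    exists_ae_eq_comp_fst_of_forall_integral_mul_fderiv_eq_zero isOpen_Ioi hFli hF0
  set ηp : ℝ → ℝ := (Ioi (0 : ℝ)).indicator η with hηp
  have hηpm : AEStronglyMeasurable ηp volume :=
    (aestronglyMeasurable_indicator_iff measurableSet_Ioi).2 hηm
  have hηpeq : ∀ t, 0 < t → ηp t = η t := fun t ht => indicator_of_mem (mem_Ioi.2 ht) η
  -- masses of `η` on `(0, τ)` in terms of `F` on `(0, τ) × B`
  have hηF : ∀ τ : ℝ, 0 < τ →
      (∫⁻ t in Ioo 0 τ, ‖ηp t‖ₑ ^ (3 / 2 : ℝ)) * volume B =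
        ∫⁻ z in Ioo 0 τ ×ˢ B, ‖F z.1 z.2‖ₑ ^ (3 / 2 : ℝ) := by
    intro τ hτ
    have hm : AEMeasurable (fun t => ‖ηp t‖ₑ ^ (3 / 2 : ℝ)) (volume.restrict (Ioo 0 τ)) :=
      (hηpm.restrict.enorm.pow_const _)
    rw [← setLIntegral_prod_comp_fst (Ioo 0 τ) B hm]
    refine lintegral_congr_ae ?_
    have hsub : Ioo 0 τ ×ˢ B ⊆ Ioi (0 : ℝ) ×ˢ (univ : Set (EuclideanSpace ℝ (Fin 3))) :=
      Set.prod_mono Ioo_subset_Ioi_self (subset_univ _)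
    filter_upwards [ae_restrict_mem (measurableSet_Ioo.prod measurableSet_ball),
      ae_restrict_of_ae_restrict_of_subset hsub hFη] with z hz hz2
    rw [hz2, hηpeq z.1 hz.1.1]
  have hFle : ∀ τ : ℝ, 0 < τ →
      ∫⁻ z in Ioo 0 τ ×ˢ B, ‖F z.1 z.2‖ₑ ^ (3 / 2 : ℝ) ≤
        two * ((∫⁻ z in Ioo 0 τ ×ˢ B, ‖πc z.1 z.2‖ₑ ^ (3 / 2 : ℝ)) +
          ∫⁻ z in Ioo 0 τ ×ˢ B, ‖π z.1 z.2‖ₑ ^ (3 / 2 : ℝ)) := by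
    intro τ hτ
    have hsub : Ioo 0 τ ×ˢ B ⊆ (Q : Set (ℝ × (EuclideanSpace ℝ (Fin 3)))) := Set.prod_mono Ioo_subset_Ioi_self (subset_univ _)
    refine htri _ πc π ?_
    exact ((hpcm.mono_measure (Measure.restrict_mono hsub le_rfl)).enorm.pow_const _)
  -- the rescaled pressure's mass on `(0, τ) × B` is that of `π` on `(0, λ²τ) × B₁`
  have hπc_mass : ∀ τ : ℝ, ∫⁻ z in Ioo 0 τ ×ˢ B, ‖πc z.1 z.2‖ₑ ^ (3 / 2 : ℝ) =
      A * ∫⁻ z in Ioo 0 (c * c * τ) ×ˢ ball (0 : (EuclideanSpace ℝ (Fin 3))) 1, ‖π z.1 z.2‖ₑ ^ (3 / 2 : ℝ) := by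
    intro τ
    have e1 : Ioo 0 τ = Ioo 0 ((c * c)⁻¹ * (c * c * τ)) := by
      rw [inv_mul_cancel_left₀ (mul_pos hc0 hc0).ne']
    have e2 : B = ball (0 : (EuclideanSpace ℝ (Fin 3))) (c⁻¹ * 1) := by rw [mul_one]
    rw [e1, e2, setLIntegral_cylinder_nsRescalePressure hc0 π (c * c * τ) 1]
  have hπ_fin : ∀ τ : ℝ, 0 < τ →
      ∫⁻ z in Ioo 0 τ ×ˢ ball (0 : (EuclideanSpace ℝ (Fin 3))) 1, ‖π z.1 z.2‖ₑ ^ (3 / 2 : ℝ) < ⊤ := fun τ hτ =>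
    (lintegral_mono_set (Set.prod_mono Subset.rfl ball_subset_closedBall)).trans_lt
      (hsol.pressure τ hτ (closedBall 0 1) (isCompact_closedBall _ _))
  have hη_fin : ∀ τ : ℝ, 0 < τ → ∫⁻ t in Ioo 0 τ, ‖ηp t‖ₑ ^ (3 / 2 : ℝ) < ⊤ := by
    intro τ hτ
    have h1 : (∫⁻ t in Ioo 0 τ, ‖ηp t‖ₑ ^ (3 / 2 : ℝ)) * volume B < ⊤ := by
      rw [hηF τ hτ]
      refine (hFle τ hτ).trans_lt (ENNReal.mul_lt_top htwo_top.lt_top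
        (ENNReal.add_lt_top.2 ⟨?_, ?_⟩))
      · rw [hπc_mass]
        exact ENNReal.mul_lt_top hA_top.lt_top (hπ_fin _ (by positivity))
      · exact (lintegral_mono_set (Set.prod_mono Subset.rfl
          (ball_subset_ball (inv_le_one_of_one_le₀ hc.le)))).trans_lt (hπ_fin τ hτ)
    exact (ENNReal.mul_lt_top_iff.1 h1).elim (fun h => h.1)
      (fun h => h.elim (fun h => by simp [h]) (fun h => absurd h hB0))
  -- Step 2: the time correction
  obtain ⟨g, hgm, hfe, -, hgbound⟩ := exists_time_correction hq0 hq1 hηpm hη_fin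
  have hg_fin : ∀ τ : ℝ, 0 < τ → ∫⁻ t in Ioo 0 τ, ‖g t‖ₑ ^ (3 / 2 : ℝ) < ⊤ := fun τ hτ =>
    (hgbound τ hτ).trans_lt (ENNReal.mul_lt_top (ENNReal.rpow_ne_top_of_nonneg hr0 hKq_top).lt_top
      (hη_fin _ (mul_pos hq0 hτ)))
  have hgm' : ∀ τ : ℝ, AEStronglyMeasurable g (volume.restrict (Ioo 0 τ)) := fun τ =>
    hgm.mono_measure (Measure.restrict_mono Ioo_subset_Ioi_self le_rfl)
  have hg_mass : ∀ (τ : ℝ) (S : Set (EuclideanSpace ℝ (Fin 3))),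
      ∫⁻ z in Ioo 0 τ ×ˢ S, ‖g z.1‖ₑ ^ (3 / 2 : ℝ) =
        (∫⁻ t in Ioo 0 τ, ‖g t‖ₑ ^ (3 / 2 : ℝ)) * volume S := fun τ S =>
    setLIntegral_prod_comp_fst (Ioo 0 τ) S ((hgm' τ).enorm.pow_const _)
  -- `g ∘ fst` is locally integrable and locally `L^{3/2}` on the slab
  have hgL1 : ∀ (τ R : ℝ), 0 < τ →
      IntegrableOn (fun z : ℝ × (EuclideanSpace ℝ (Fin 3)) => g z.1) (Ioo 0 τ ×ˢ ball (0 : (EuclideanSpace ℝ (Fin 3))) R) volume := by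
    intro τ R hτ
    have h1 : IntegrableOn g (Ioo 0 τ) volume :=
      integrableOn_Ioo_of_lintegral_rpow_lt_top (hgm' τ) (hg_fin τ hτ)
    haveI : IsFiniteMeasure ((volume : Measure (EuclideanSpace ℝ (Fin 3))).restrict (ball (0 : (EuclideanSpace ℝ (Fin 3))) R)) :=
      ⟨by rw [Measure.restrict_apply_univ]; exact measure_ball_lt_top⟩
    have h2 : Integrable (fun z : ℝ × (EuclideanSpace ℝ (Fin 3)) => g z.1 * (fun _ : (EuclideanSpace ℝ (Fin 3)) => (1 : ℝ)) z.2)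
        (((volume : Measure ℝ).restrict (Ioo 0 τ)).prod
          ((volume : Measure (EuclideanSpace ℝ (Fin 3))).restrict (ball (0 : (EuclideanSpace ℝ (Fin 3))) R))) :=
      h1.mul_prod (integrable_const (1 : ℝ))
    rw [IntegrableOn, Measure.volume_eq_prod, ← Measure.prod_restrict]
    simpa only [mul_one] using h2
  have hgli : LocallyIntegrableOn (fun z : ℝ × (EuclideanSpace ℝ (Fin 3)) => g z.1) (Q : Set (ℝ × (EuclideanSpace ℝ (Fin 3)))) volume := by
    intro z hz
    have hz1 : 0 < z.1 := by
      rw [hQcoe] at hz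
      exact hz.1
    refine ⟨Ioo 0 (z.1 + 1) ×ˢ ball (0 : (EuclideanSpace ℝ (Fin 3))) (‖z.2‖ + 1), mem_nhdsWithin_of_mem_nhds ?_,
      hgL1 _ _ (by linarith)⟩
    exact (isOpen_Ioo.prod isOpen_ball).mem_nhds
      ⟨⟨hz1, lt_add_one _⟩, mem_ball_zero_iff.2 (lt_add_one _)⟩
  have hgK : ∀ K ⊆ (Q : Set (ℝ × (EuclideanSpace ℝ (Fin 3)))), IsCompact K →
      ∫⁻ z in K, ‖g z.1‖ₑ ^ (3 / 2 : ℝ) < ⊤ := by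
    intro K hK hKc
    obtain ⟨T', R, hTR⟩ := BradshawTsai2019.exists_bounds_of_isCompact_subset_slab hK hKc
    have hsub : K ⊆ Ioo 0 (max T' 1) ×ˢ ball (0 : (EuclideanSpace ℝ (Fin 3))) R := fun z hz =>
      ⟨⟨(hTR z hz).1, (hTR z hz).2.1.trans_le (le_max_left _ _)⟩,
        mem_ball_zero_iff.2 (hTR z hz).2.2⟩
    refine (lintegral_mono_set hsub).trans_lt ?_
    rw [hg_mass]
    exact ENNReal.mul_lt_top (hg_fin _ (by positivity)) measure_ball_lt_top
  -- Step 3: the corrected pressure `π₀ = π - g`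
  set π₀ : ℝ → (EuclideanSpace ℝ (Fin 3)) → ℝ := fun t x => π t x - g t with hπ₀
  have hsw₀ : IsSuitableWeakSolutionOn Q 1 0 v π₀ := hsw.sub_pressure hgli hgK
  have hpress₀ : ∀ T : ℝ, 0 < T → ∀ K : Set (EuclideanSpace ℝ (Fin 3)), IsCompact K →
      ∫⁻ z in Ioo 0 T ×ˢ K, ‖π₀ z.1 z.2‖ₑ ^ (3 / 2 : ℝ) < ⊤ := by
    intro T hT K hK
    have hsub : Ioo 0 T ×ˢ K ⊆ (Q : Set (ℝ × (EuclideanSpace ℝ (Fin 3)))) := Set.prod_mono Ioo_subset_Ioi_self (subset_univ _)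
    have h1 := htri (Ioo 0 T ×ˢ K) π (fun t _ => g t)
      ((hpm.mono_measure (Measure.restrict_mono hsub le_rfl)).enorm.pow_const _)
    refine h1.trans_lt (ENNReal.mul_lt_top htwo_top.lt_top (ENNReal.add_lt_top.2 ⟨?_, ?_⟩))
    · exact hsol.pressure T hT K hK
    · rw [hg_mass]
      exact ENNReal.mul_lt_top (hg_fin T hT) hK.measure_lt_top
  have hsol₀ : IsLocalLeraySolution 1 v₀ v π₀ :=
    { suitable := hsw₀
      sqIntegrable := hsol.sqIntegrable
      pressure := hpress₀
      uniformLocalEnergy := hsol.uniformLocalEnergy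
      uniformLocalGradient := hsol.uniformLocalGradient
      initial := hsol.initial
      decay := hsol.decay }
  -- Step 4: `π₀` is a.e. DSS
  have hdss₀ : ∀ᵐ z ∂((volume : Measure (ℝ × (EuclideanSpace ℝ (Fin 3)))).restrict (Ioi (0 : ℝ) ×ˢ (univ : Set (EuclideanSpace ℝ (Fin 3))))),
      nsRescalePressure c π₀ z.1 z.2 = π₀ z.1 z.2 := by
    -- the cohomological equation at `λ² t`
    have hfe' : ∀ᵐ t ∂((volume : Measure ℝ).restrict (Ioi 0)),
        c ^ 2 * g (c ^ 2 * t) = η t + g t := by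
      filter_upwards [ae_restrict_Ioi_comp_mul_left hc2 hfe, ae_restrict_mem measurableSet_Ioi]
        with t ht ht0
      rw [← mul_assoc, hqc, one_mul, hηpeq t ht0] at ht
      have e : c ^ 2 * g (c ^ 2 * t) = c ^ 2 * (q * η t + q * g t) := by rw [ht]
      rw [e, mul_add, ← mul_assoc, ← mul_assoc, mul_comm (c ^ 2) q, hqc, one_mul, one_mul]
    have hprod : (volume : Measure (ℝ × (EuclideanSpace ℝ (Fin 3)))).restrict (Ioi (0 : ℝ) ×ˢ (univ : Set (EuclideanSpace ℝ (Fin 3)))) =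
        ((volume : Measure ℝ).restrict (Ioi 0)).prod volume := by
      rw [Measure.volume_eq_prod, Measure.restrict_prod_eq_prod_univ]
    have hfe'' : ∀ᵐ z ∂((volume : Measure (ℝ × (EuclideanSpace ℝ (Fin 3)))).restrict (Ioi (0 : ℝ) ×ˢ (univ : Set (EuclideanSpace ℝ (Fin 3))))),
        c ^ 2 * g (c ^ 2 * z.1) = η z.1 + g z.1 := by
      rw [hprod]
      exact (Measure.quasiMeasurePreserving_fst (μ := (volume : Measure ℝ).restrict (Ioi 0))
        (ν := (volume : Measure (EuclideanSpace ℝ (Fin 3))))).ae hfe'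
    filter_upwards [hfe'', hFη] with z hz1 hz2
    have e : F z.1 z.2 = c ^ 2 * π (c ^ 2 * z.1) (c • z.2) - π z.1 z.2 := by
      simp only [hF, hπc, nsRescalePressure_apply]
    rw [nsRescalePressure_apply]
    simp only [hπ₀]
    rw [mul_sub, hz1]
    rw [e] at hz2
    linarith
  -- Step 5: the exactly DSS representative
  obtain ⟨π', hdss', hπ'eq⟩ := exists_nsRescalePressure_eq_of_ae hc hdss₀
  have hsol' : IsLocalLeraySolution 1 v₀ v π' :=
    { suitable := hsw₀.congr_pressure_ae hπ'eq
      sqIntegrable := hsol.sqIntegrable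
      pressure := by
        intro T hT K hK
        have hsub : Ioo 0 T ×ˢ K ⊆ Ioi (0 : ℝ) ×ˢ (univ : Set (EuclideanSpace ℝ (Fin 3))) :=
          Set.prod_mono Ioo_subset_Ioi_self (subset_univ _)
        calc ∫⁻ z in Ioo 0 T ×ˢ K, ‖π' z.1 z.2‖ₑ ^ (3 / 2 : ℝ)
            = ∫⁻ z in Ioo 0 T ×ˢ K, ‖π₀ z.1 z.2‖ₑ ^ (3 / 2 : ℝ) :=
              lintegral_congr_ae (by
                filter_upwards [ae_restrict_of_ae_restrict_of_subset hsub hπ'eq] with z hz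
                rw [hz])
          _ < ⊤ := hpress₀ T hT K hK
      uniformLocalEnergy := hsol.uniformLocalEnergy
      uniformLocalGradient := hsol.uniformLocalGradient
      initial := hsol.initial
      decay := hsol.decay }
  refine ⟨π', hsol', hdss', fun T hT => ?_⟩
  -- Step 6: the bound on the unit cylinder
  set PT := ∫⁻ z in Ioo 0 T ×ˢ ball (0 : (EuclideanSpace ℝ (Fin 3))) 1, ‖π z.1 z.2‖ₑ ^ (3 / 2 : ℝ) with hPT
  have hsubT : Ioo 0 T ×ˢ ball (0 : (EuclideanSpace ℝ (Fin 3))) 1 ⊆ Ioi (0 : ℝ) ×ˢ (univ : Set (EuclideanSpace ℝ (Fin 3))) :=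
    Set.prod_mono Ioo_subset_Ioi_self (subset_univ _)
  -- (a) `η` on `(0, qT)`
  have ha : (∫⁻ t in Ioo 0 (q * T), ‖ηp t‖ₑ ^ (3 / 2 : ℝ)) * volume B ≤ two * (A + 1) * PT := by
    rw [hηF _ (mul_pos hq0 hT)]
    refine (hFle _ (mul_pos hq0 hT)).trans ?_
    rw [mul_assoc, add_mul, one_mul]
    gcongr
    · have e : c * c * (q * T) = T := by
        rw [hcc, ← mul_assoc, mul_comm (c ^ 2) q, hqc, one_mul]
      rw [hPT, hπc_mass, e]
    · exact lintegral_mono_set (Set.prod_mono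
        (Ioo_subset_Ioo_right (mul_le_of_le_one_left hT.le hq1.le))
        (ball_subset_ball (inv_le_one_of_one_le₀ hc.le)))
  have ha' : ∫⁻ t in Ioo 0 (q * T), ‖ηp t‖ₑ ^ (3 / 2 : ℝ) ≤
      (volume B)⁻¹ * (two * (A + 1) * PT) := by
    calc ∫⁻ t in Ioo 0 (q * T), ‖ηp t‖ₑ ^ (3 / 2 : ℝ)
        = (volume B)⁻¹ * ((∫⁻ t in Ioo 0 (q * T), ‖ηp t‖ₑ ^ (3 / 2 : ℝ)) * volume B) := by
          rw [mul_comm _ (volume B), ← mul_assoc, ENNReal.inv_mul_cancel hB0 hBtop, one_mul]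
      _ ≤ (volume B)⁻¹ * (two * (A + 1) * PT) := by gcongr
  -- (b) `g` on `(0, T)`
  have hb : ∫⁻ t in Ioo 0 T, ‖g t‖ₑ ^ (3 / 2 : ℝ) ≤
      Kq ^ (3 / 2 : ℝ) * ((volume B)⁻¹ * (two * (A + 1) * PT)) :=
    (hgbound T hT).trans (by gcongr)
  -- (c) `π₀` and `π'` on the unit cylinder
  have hc' : ∫⁻ z in Ioo 0 T ×ˢ ball (0 : (EuclideanSpace ℝ (Fin 3))) 1, ‖π₀ z.1 z.2‖ₑ ^ (3 / 2 : ℝ) ≤ K * PT := by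
    have h1 := htri (Ioo 0 T ×ˢ ball (0 : (EuclideanSpace ℝ (Fin 3))) 1) π (fun t _ => g t)
      ((hpm.mono_measure (Measure.restrict_mono hsubT le_rfl)).enorm.pow_const _)
    refine h1.trans ?_
    rw [hg_mass, hK, mul_assoc two, add_mul, one_mul]
    gcongr two * (PT + ?_)
    calc (∫⁻ t in Ioo 0 T, ‖g t‖ₑ ^ (3 / 2 : ℝ)) * volume (ball (0 : (EuclideanSpace ℝ (Fin 3))) 1)
        ≤ Kq ^ (3 / 2 : ℝ) * ((volume B)⁻¹ * (two * (A + 1) * PT)) * volume (ball (0 : (EuclideanSpace ℝ (Fin 3))) 1) := by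
          gcongr
      _ = volume (ball (0 : (EuclideanSpace ℝ (Fin 3))) 1) * (Kq ^ (3 / 2 : ℝ) * ((volume B)⁻¹ * (two * (A + 1)))) * PT := by
          ring
  calc ∫⁻ z in Ioo 0 T ×ˢ ball (0 : (EuclideanSpace ℝ (Fin 3))) 1, ‖π' z.1 z.2‖ₑ ^ (3 / 2 : ℝ)
      = ∫⁻ z in Ioo 0 T ×ˢ ball (0 : (EuclideanSpace ℝ (Fin 3))) 1, ‖π₀ z.1 z.2‖ₑ ^ (3 / 2 : ℝ) :=
        lintegral_congr_ae (by
          filter_upwards [ae_restrict_of_ae_restrict_of_subset hsubT hπ'eq] with z hz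
          rw [hz])
    _ ≤ K * PT := hc'

end DSSPressure

/-! ### Proposition 3.1 with the DSS pressure, from Proposition 3.1 -/

section Prop31

/-- **Bradshaw–Tsai 2019, Prop. 3.1 with the DSS invariance of the pressure, from Prop. 3.1 as
rendered** (arXiv:1801.08060, p. 8, and the normalisation of the pressure in its proof, p. 9):
the named fact `bradshawTsai2019_prop_3_1_dss` follows from the accepted
`bradshawTsai2019_prop_3_1`. Given `λ > 1` and `M`, take `T`, `C` from Prop. 3.1 and the constant
`K(λ)` of `IsLocalLeraySolution.exists_dss_pressure`; for each admissible datum replace the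
pressure `π` of the `λ`-DSS local Leray solution `(v, π)` by the `λ`-DSS pressure `π'`, for which
`(v, π')` is still a local Leray solution with the same velocity (hence the same energy and
gradient bounds) and `∫₀ᵀ∫_{B₁} |π'|^{3/2} ≤ K C`. So the clause "the pressure is `λ`-DSS" costs
nothing: the trust base `{Lemma 4.1, Prop. 3.1_dss, §4.3_local}` of
`bradshawTsai2019_dss_existence_of_local_parts` reduces to `{Lemma 4.1, Prop. 3.1, §4.3_local}`.
[cite: BradshawTsai2019, Prop 3.1 and its proof (arXiv pp. 8–9)] -/
theorem bradshawTsai2019_prop_3_1_dss_of_prop_3_1 (h31 : bradshawTsai2019_prop_3_1) :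
    bradshawTsai2019_prop_3_1_dss := by
  intro c hc M
  obtain ⟨T, hT, C, hTC⟩ := h31 hc M
  obtain ⟨K, hK, hKsol⟩ := IsLocalLeraySolution.exists_dss_pressure hc
  have hKC : K * C ≠ ⊤ := ENNReal.mul_ne_top hK.ne ENNReal.coe_ne_top
  refine ⟨T, hT, max C (K * C).toNNReal, fun hw hdiv hdss hM => ?_⟩
  obtain ⟨v, π, hsol, hdssv, hE, hG, hP⟩ := hTC hw hdiv hdss hM
  obtain ⟨π', hsol', hdssπ, hbound⟩ := hKsol hsol hdssv
  have hC1 : ((C : ℝ≥0) : ℝ≥0∞) ≤ (max C (K * C).toNNReal : ℝ≥0) :=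
    ENNReal.coe_le_coe.2 (le_max_left _ _)
  have hC2 : K * C ≤ (max C (K * C).toNNReal : ℝ≥0) := by
    rw [← ENNReal.coe_toNNReal hKC]
    exact ENNReal.coe_le_coe.2 (le_max_right _ _)
  refine ⟨v, π', hsol', hdssv, hdssπ, ?_, ?_, ?_⟩
  · filter_upwards [hE] with t ht
    exact ht.trans hC1
  · obtain ⟨G, hG1, hG2⟩ := hG
    exact ⟨G, hG1, hG2.trans hC1⟩
  · exact ((hbound T hT).trans (mul_le_mul' le_rfl hP)).trans hC2

/-- **Theorem 1.2 of Bradshaw–Tsai 2019 from Lemma 4.1, Prop. 3.1 (as rendered) and the localized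
limit fact**: the trust base of `bradshawTsai2019_dss_existence` is
`{bradshawTsai2019_lemma_4_1, bradshawTsai2019_prop_3_1, bradshawTsai2019_limit_4_3_local}` — the
DSS invariance of the pressures (`bradshawTsai2019_prop_3_1_dss`) being proved from Prop. 3.1 and
the re-scaling argument of §4.3 being proved in `ForwardDSSExtension`. [cite: BradshawTsai2019, §4.3 (proof of Thm 1.2)] -/
theorem bradshawTsai2019_dss_existence_of_prop_3_1_local (h41 : bradshawTsai2019_lemma_4_1)
    (h31 : bradshawTsai2019_prop_3_1) (h43 : bradshawTsai2019_limit_4_3_local) :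
    bradshawTsai2019_dss_existence :=
  bradshawTsai2019_dss_existence_of_local_parts h41 (bradshawTsai2019_prop_3_1_dss_of_prop_3_1 h31)
    h43

/-- The historical `chae_wolf_dss_existence` from the same reduced trust base. [cite: BradshawTsai2019, Thm 1.2] -/
theorem chae_wolf_dss_existence_of_prop_3_1_local (h41 : bradshawTsai2019_lemma_4_1)
    (h31 : bradshawTsai2019_prop_3_1) (h43 : bradshawTsai2019_limit_4_3_local) :
    chae_wolf_dss_existence :=
  chae_wolf_dss_existence_of_local_parts h41 (bradshawTsai2019_prop_3_1_dss_of_prop_3_1 h31) h43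

/-- Likewise `chaeWolf2018_dss_existence` from the reduced trust base. [cite: BradshawTsai2019, Comments on Thm 1.2] -/
theorem chaeWolf2018_dss_existence_of_prop_3_1_local (h41 : bradshawTsai2019_lemma_4_1)
    (h31 : bradshawTsai2019_prop_3_1) (h43 : bradshawTsai2019_limit_4_3_local) :
    chaeWolf2018_dss_existence :=
  chaeWolf2018_dss_existence_of_local_parts h41 (bradshawTsai2019_prop_3_1_dss_of_prop_3_1 h31) h43

end Prop31

end Literature.Analysis.FluidPDE
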